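import Literature.MathematicalPhysics.QuantumFieldTheory.Balaban1983to89.B5SectBStatements
import Literature.MathematicalPhysics.QuantumFieldTheory.Balaban1983to89.B5SectAStatements
import Literature.MathematicalPhysics.QuantumFieldTheory.Balaban1983to89.B5GaussSectC

/-!
# `Balaban1983to89.B5Eq114Gauss` — T. Bałaban, *Propagators and renormalization transformations for lattice gauge
# theories. I*, Commun. Math. Phys. **95** (1984) 17–40 [Balaban1984PropagatorsI]: «The integral in (1.12) is obviously a
# Gaussian integral», «It is easily seen that a composition of k transformations is given by (1.17)» — (1.14)
# COMPUTED with explicit `Z^{(0)}`, `Δ₁` and PROVED (d ≥ 2) via the positivity claim of p. 19 transported from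
# `B5SectAStatements.claimP19_holds`; (1.16), (1.17) and (1.19) PROVED FOR EVERY `k` (d ≥ 2) by the δ-calculus of
# linear constraints; Phase-2 companion of `B5SectBStatements`

statement-level skeleton of published theorems with citation tags; proofs where landed; nothing here is a claim about the Yang–Mills mass gap

PDF held: `paper:balaban1984-cmp95-propagators-rt-i` (journal page = PDF page + 16); pages read AS IMAGES: renders
`run/shared/lean/pub/pub-balaban/b2b-balaban-ref1/pages/1984-cmp95-propagators-rt-I/…-p003-x2.png` (p. 19), `…-p004-x2.png`
(p. 20).

CITATION HEADER (lean-in-tree rule).  Cell `lit-balaban`, unit `lit-balaban-r02` gen 2 (B5 fold owner); WHAT IS REPRODUCED =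
the PROOF side of SKELETON rows `B5.Eq1.14`, `B5.Eq1.17` (with (1.16)), `B5.Eq1.19` of
`run/shared/lean/pub/lit-balaban/lit-balaban-r02/ROWS-B5.md`, whose typed statements `Eq114`, `Eq117`, `Eq119` live in
`B5SectBStatements` (this seat, p243630).  Kind «discharge»: the typed claims `Eq114`, `Eq116`, `Eq117 k`, `Eq119 k`
are PROVED for every `k` under the single hypothesis `2 ≤ d` (the p. 19 positivity, which the source proves in
part II, enters through `B5SectAStatements.claimP19_holds`; hypothesis-free computed forms are kept alongside).

WHAT IS PRINTED (verbatim).  p. 19 [PDF 3]: «The integral in (1.12) is obviously a Gaussian integral. We will prove later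
that the quadratic form ⟨∂A, ∂A⟩ is positive on the subspace of A satisfying QA = 0, A(Γ_{y,x}) = 0, x∈B(y), y∈T_L^{(1)}.
A result of the integration is obviously a Gaussian density (Te^{−S})(B) = Z^{(0)} exp(−½⟨B, Δ₁B⟩) = Z^{(0)} exp(−S₁(B)).
(1.14)»; p. 20 [PDF 4]: «It is easily seen that a composition of k transformations is given by ((ST)^k e^{−S})(B) =
z^{(k)} ∫dA δ(B − Q_kA) δ_Ax(Q_{k−1}A)·…·δ_Ax(A) e^{−S^η(A)}, (1.17)» («z^{(k)} is a numerical factor coming from scaling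
transformations»); «We define ((ST)^k e^{−S})(B) = Z_{k,Ax} exp(−½⟨B, Δ_kB⟩). (1.19) It is easily seen that Z_{k,Ax} =
Z^{(k−1)}·…·Z^{(0)}»; p. 18 (1.5) «A_μ(εx) = ε^{−(d−2)/2}A_μ(x) … S(A) = ½ Σ_{p⊂T₁} |(∂A)(p)|²».

WHAT THIS FILE PROVES (kernel-checked, 0 sorry, axioms ⊆ {propext, Classical.choice, Quot.sound}).
§6 **(1.17) at k = 1**: `iterST_one_eq : ((ST)e^{−S})(B) = σ^{dim(N(Q)∩Ax)}·rt17 1 B` for every `B` (σ = L^{−(d−2)/2},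
   η = L^{−1}), hence `eq117_one : Eq117 L M 1` with `z^{(1)} = σ^{dim N(Q)∩Ax}` — from (1.5) `B5SectAStatements.eq15`
   read as `S(σA) = S^η(A)` (`action1_sigma_smul`), base-point independence and the axial section of
   `B5SectBStatements`, and the scaling of the Euclidean volume of the direction space (`Measure.integral_comp_inv_smul`):
   the typed readings of `S`, `T`, `Q`, `S^η` check against each other.
§7 **(1.14) COMPUTED**: `S(A) = ½‖𝒯A‖²` for the linear curvature map `curvLin` (`action1_eq_half_norm_sq`, dictionary
   `Fs_cplx` with `B5Action121.Fs`); the generic subspace Gaussian lemma `integral_gaussW_sub_T` (∫_N γ_α(f − 𝒯x)dx =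
   Z·γ_α(f − Rf), the `B5GaussSectC.integral_124` pattern for a map into ANOTHER space); `rt12_gauss : (Te^{−S})(B) =
   Z^{(0)}·exp(−½⟨B, Δ₁B⟩)` for EVERY `B`, with the EXPLICIT `Z0 = ∫_{N(Q)∩Ax} e^{−S(v)}dv` (`Z0_eq`) and `Delta1 = W^†W`,
   `W = (1 − R)𝒯∘sec` (`R` = orthogonal projection onto `𝒯(N(Q)∩Ax)`; `Delta1_symm`, `inner_Delta1`); §7.4 the same
   after one rescaling: `iterST_one_gauss` (Z_{1,Ax} = Z^{(0)} — «Z_{k,Ax} = Z^{(k−1)}⋯Z^{(0)}» at k = 1 — and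
   Δ_1 = σ²Δ₁); §7.5 `Z0 > 0` from injectivity of `𝒯` on `N(Q)∩Ax` (coercivity on the unit sphere + Gaussian majorant,
   the `B5Hk164Transl.exists_sq_norm_le_cEnergy` pattern): `Z0_pos_of_claimP19`, hence
   **`eq114_of_claimP19 : (∀ A ∈ N(Q)∩Ax, S(A) = 0 → A = 0) → Eq114`** and `eq119_one_of_claimP19`.
§8 **the p. 19 positivity TRANSPORTED and (1.14) PROVED**: a real torus field read as a periodic configuration on the
   unit bonds of `ℤ^d` (`liftCfg`; `toTor`, `isPeriodic_liftCfg`), with the dictionary `normSqT_liftCfg : ‖A‖²_{T₁} =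
   ‖A‖²`, `d1SqT_liftCfg : Σ_p|∂A(p)|² = ‖𝒯A‖²`, `contourSum_liftCfg : A(Γ_{y,x}) = axSum` (the (1.7) staircase, a
   bijection `B6BondElimination.contour ≃ {(ν,t) : t < j_ν}`), `q1_liftCfg : (Q₁A)(c) = (QA)(y′,μ)` ((1.11), blocks of
   `ℤ^d` ↔ block offsets `sum_block_eq`); whence `claimP19_tor : ∀ A ∈ N(Q)∩Ax, S(A) = 0 → A = 0` (d ≥ 2) from
   `B5SectAStatements.claimP19_holds`, **`Z0_pos : 0 < Z^{(0)}`, `eq114_holds : 2 ≤ d → Eq114 L M`,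
   `eq119_one_holds : 2 ≤ d → Eq119 L M 1`** — every `L ≥ 1`, every torus `M`, U = 1.
§9 **(1.16)/(1.17)/(1.19) FOR EVERY `k`** — the δ-calculus of linear constraints: §9.1 the printed middle step of
   (1.16) «∫dB δ(C − QB)δ_Ax(B)∫dA δ(B − QA)δ_Ax(A)ρ = z∫dA δ(C − Q₂A)δ_Ax(QA)δ_Ax(A)ρ» as the generic
   `deltaInt_comp` (inner constraint with a linear section inside its gauge subspace ⇒ the splitting
   `N(C′)∩G′ × N(C)∩G ≃ N(C′C) ∩ (G ⊓ C⁻¹G′)`, `splitEquiv`; Jacobian = a positive `addHaarScalarFactor`,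
   `exists_map_splitEquiv`; Fubini; integrability inherited by the inner δ-integral, `integrable_deltaInt_shift`);
   §9.2 dilations `deltaInt_smul_pt` («z^{(k)} is a numerical factor coming from scaling transformations») and the
   zero-dimensional case `deltaInt_of_dirSpace_eq_bot`; §9.3 discrete Stokes `square_stokes` and `curvLin_Qlin_eq_zero :
   ∂A = 0 ⇒ ∂(QA) = 0`; §9.4 **`tower_pos`: the hierarchical axial gauge is complete** (`Q_kA = 0`, `A, …, Q_{k−1}A`
   axial, `S(A) = 0 ⇒ A = 0`, induction from `claimP19_tor`); §9.5 convergence `integrable_exp_neg_action1_fibre`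
   (affine Gaussians, `integrable_gaussW_affine`); §9.6 `iterST_eq_deltaInt : ((ST)^kρ)(B) = z^{(k)}∫dA δ(B − Q_kA)
   δ_Ax⋯δ_Ax ρ(σ^kA)` for every admissible density (induction on `k`), the level-`k` scaling `action1_sigma_pow_smul :
   S(σ^kA) = S^η(A)` from (1.5), hence **`eq117_holds : 2 ≤ d → ∀ k, Eq117 L M k`**, **`eq116_holds : 2 ≤ d → Eq116 L M`**;
   §9.7 the composite axial section `secK` (`Q_k sec_k = 1`, values in `AxAll k`), `rt17_gauss : rt17 k B = Z^{(k)}·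
   exp(−½⟨B, Δ_kB⟩)` with the EXPLICIT `Zk` and `DeltaK k = W_k^†W_k`, `W_k = (1 − R_k)σ^k𝒯∘sec_k`, `Zk_pos`, hence
   **`eq119_holds : 2 ≤ d → ∀ k, Eq119 L M k`** with `Z_{k,Ax} = z^{(k)}Z^{(k)}`.

HONEST SCOPE.  (i) `eq114_holds` / `eq119_one_holds` / `Z0_pos` carry the single hypothesis `2 ≤ d` (the
p. 19 positivity is false for d = 1 only vacuously-typed there; the source works in d ≥ 2 throughout); the hypothesis-
free forms `eq114_of_claimP19`/`eq119_one_of_claimP19` keep EXACTLY the printed p. 19 positivity («⟨∂A, ∂A⟩ is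
positive on the subspace … QA = 0, A(Γ_{y,x}) = 0») on the `Tor` carrier as their premise, and §8 DISCHARGES it from
`B5SectAStatements.claimP19_holds` (part II, Lemma 2.4, formalized on the periodic-configuration carrier
`B6Lemma24Torus.Cfg`) through the carrier bridge `liftCfg` (periodic `Cfg` ← `Fld (fine L M)`: norms `normSqT_liftCfg`,
curvature `d1SqT_liftCfg`, contours (1.7) `contourSum_liftCfg`, averages (1.11) `q1_liftCfg`); no new `def … : Prop`
is introduced anywhere in the file.  (ii) `rt12_gauss`, `iterST_one_eq`,
`iterST_one_gauss` hold for every `B` with NO hypothesis (for a degenerate form both sides would be the junk value 0·…,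
which is why `0 < Z0` is the content of (1.14)).  (iii) (1.16)/(1.17)/(1.19) hold for every `k` with EXISTENTIAL numerical factors `z^{(k)}`,
`Z_{k,Ax}` (the print does not evaluate them either: «z^{(k)} is a numerical factor coming from scaling transformations»);
the product sentence «Z_{k,Ax} = Z^{(k−1)}⋯Z^{(0)}» is represented by `Z_{k,Ax} = z^{(k)}·Zk k` with `Zk` one Gaussian
normalisation of the composite fibre, not as a k-fold product (reading, not separately typed in `B5SectBStatements`).  (iv) U = 1, every d, L ≥ 1, every torus.
Value = kernel certificates of the one-step Gaussian bookkeeping of Sect. A/B, (1.14) included; NOT summit progress.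
-/

open scoped BigOperators Matrix
open Finset MeasureTheory

namespace Literature.MathematicalPhysics.QuantumFieldTheory.Balaban1983to89.B5Eq114Gauss

open B5Prop11Plancherel (Tor fine unitVec)
open B5Block118 (bpt tstep QvOp QsOp)
open B5Action121 (actionS divS gaugeT GradOp)
open B5SectBStatements

noncomputable section

/-! ## §6  (1.17) at `k = 1` PROVED: `((ST)e^{−S})(B) = z^{(1)}∫dA δ(B − QA)δ_Ax(A)e^{−S^η(A)}`, `z^{(1)} = σ^{dim N}`

The typings of §4 are checked against each other: one renormalization step followed by the rescaling `S` (read through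
(1.5)) IS the right-hand side of (1.17) at `k = 1` with the η-lattice action, `η = L^{−1}`, up to the numerical factor
`z^{(1)} = σ^{dim N(Q)∩Ax}`, `σ = L^{−(d−2)/2}` — *"z^{(k)} is a numerical factor coming from scaling transformations"*.
Ingredients: (1.5) `S^ε(A^ε) = S(A)` (`B5SectAStatements.eq15`), base-point independence (§1), non-vacuity (§2b), and
the scaling of the Euclidean volume of the direction space (`Measure.integral_comp_inv_smul`). -/

section Eq117One

variable {d : ℕ} (L : ℕ) (M : Fin d → ℕ) [NeZero L] [hM : ∀ μ, NeZero (M μ)]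

/-- the factor `σ = L^{−(d−2)/2}` of the rescaling `S` (`scaleDens`). [cite: Balaban1984PropagatorsI, (1.5) p.18] -/
def sigmaL (d L : ℕ) : ℝ := (L : ℝ) ^ (-(((d : ℝ) - 2) / 2))

omit [NeZero L] hM in
/-- `scaleDens` is precomposition with the dilation by `σ`. [cite: Balaban1984PropagatorsI, (1.5) p.18] -/
theorem scaleDens_apply {N : Fin d → ℕ} (g : Fld N → ℝ) (B : Fld N) : scaleDens L g B = g (sigmaL d L • B) := rfl

omit hM in
/-- `σ > 0`. [cite: Balaban1984PropagatorsI, (1.5) p.18] -/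
theorem sigmaL_pos : 0 < sigmaL d L := by
  have hL : (0 : ℝ) < L := by exact_mod_cast Nat.pos_of_ne_zero (NeZero.ne L)
  exact Real.rpow_pos_of_pos hL _

omit hM in
/-- `η^{−(d−2)/2}·σ = 1` for `η = L^{−1}`: the (1.5)-rescaling from the `L^{−1}`-lattice undoes `S`.
[cite: Balaban1984PropagatorsI, (1.5) p.18] -/
theorem eta_rpow_mul_sigmaL : ((L : ℝ)⁻¹) ^ (-(((d : ℝ) - 2) / 2)) * sigmaL d L = 1 := by
  have hL : (0 : ℝ) < L := by exact_mod_cast Nat.pos_of_ne_zero (NeZero.ne L)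
  rw [sigmaL, Real.inv_rpow hL.le, ← Real.rpow_neg hL.le, neg_neg, ← Real.rpow_add hL, add_neg_cancel,
    Real.rpow_zero]

omit [NeZero L] hM in
/-- complexification commutes with real scalars. [cite: Balaban1984PropagatorsI, (1.1) p.18] -/
theorem cplx_smul {N : Fin d → ℕ} (c : ℝ) (A : Fld N) : cplx (c • A) = (c : ℂ) • cplx A := by
  funext i
  simp [cplx]

/-- the η-lattice action at `η = L^{−1}` of a real field on `T_{L^{−1}}` (sites `L·M_μ`): (1.3) with lattice factor `L`
and plaquette weight `L^{−d}` — the `k = 1` instance of `actionEta`, written on the `fine L M` carrier.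
[cite: Balaban1984PropagatorsI, (1.3) p.18] -/
def actionEta1 (A : Fld (fine L M)) : ℝ := actionS (fine L M) (L : ℂ) (((L : ℝ)⁻¹) ^ d) (cplx A)

/-- `actionEta L M 1` IS `actionEta1` (`L^1 = L`, `η = (L^1)^{−1}`). [cite: Balaban1984PropagatorsI, (1.3) p.18] -/
theorem actionEta_one (A : Fld (fine L M)) : actionEta L M 1 A = actionEta1 L M A := by
  simp only [actionEta, actionEta1, eta, pow_one]
  rfl

/-- **`S(σA) = S^η(A)`**, `η = L^{−1}`: the unit-lattice action of the dilated field is the η-lattice action (1.3) of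
the field — (1.5) `B5SectAStatements.eq15` read backwards. [cite: Balaban1984PropagatorsI, (1.5) p.18] -/
theorem action1_sigma_smul (A : Fld (fine L M)) : action1 (sigmaL d L • A) = actionEta1 L M A := by
  have hL : (0 : ℝ) < L := by exact_mod_cast Nat.pos_of_ne_zero (NeZero.ne L)
  have hη : (0 : ℝ) < (L : ℝ)⁻¹ := inv_pos.mpr hL
  have h15 := B5SectAStatements.eq15 (fine L M) hη (cplx (sigmaL d L • A))
  have hres : B5SectAStatements.rescale15 (fine L M) (L : ℝ)⁻¹ (cplx (sigmaL d L • A)) = cplx A := by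
    rw [B5SectAStatements.rescale15, cplx_smul, smul_smul, ← Complex.ofReal_mul, eta_rpow_mul_sigmaL,
      Complex.ofReal_one, one_smul]
  rw [hres, B5SectAStatements.action15, Complex.ofReal_inv, inv_inv, Complex.ofReal_natCast] at h15
  rw [action1, actionEta1, ← h15]

omit hM in
/-- dilation preserves the axial fibres: `A ∈ {QA = B, axial} ⇒ cA ∈ {QA = cB, axial}`.
[cite: Balaban1984PropagatorsI, (1.12) p.19] -/
theorem smul_mem_fibre {n : ℕ} [NeZero n] (c : ℝ) {B : Fld M} {A : Fld (fine n M)}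
    (hA : A ∈ fibre (Qlin n M) (Ax n M) B) : c • A ∈ fibre (Qlin n M) (Ax n M) (c • B) :=
  ⟨by rw [map_smul, hA.1], Submodule.smul_mem _ c hA.2⟩

/-- **one step and one rescaling, computed**: `S[Te^{−S}](B) = σ^{dim(N(Q)∩Ax)} ∫dA δ(B − QA)δ_Ax(A)e^{−S^η(A)}`,
`σ = L^{−(d−2)/2}`, `η = L^{−1}` — by (1.5), base-point independence, non-vacuity and the scaling of the Euclidean
volume of the direction space. [cite: Balaban1984PropagatorsI, (1.17) p.20] -/
theorem scaleDens_rt12_eq (B : Fld M) :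
    scaleDens L (rt12 L M) B
      = sigmaL d L ^ Module.finrank ℝ (dirSpace (Qlin L M) (Ax L M)) *
          deltaInt (Qlin L M) (Ax L M) (fun A => Real.exp (-actionEta1 L M A)) B := by
  have hσ0 : sigmaL d L ≠ 0 := (sigmaL_pos (d := d) L).ne'
  have hA₁ : secFld L M B ∈ fibre (Qlin L M) (Ax L M) B := ⟨Qlin_secFld L M B, secFld_mem_Ax L M B⟩
  rw [scaleDens_apply, rt12, rtT, deltaInt_eq _ (smul_mem_fibre (d := d) M (sigmaL d L) hA₁), deltaInt_eq _ hA₁]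
  set g : dirSpace (Qlin L M) (Ax L M) → ℝ :=
    fun w => Real.exp (-actionEta1 L M (secFld L M B + (w : Fld (fine L M)))) with hg
  have key : ∀ v : dirSpace (Qlin L M) (Ax L M),
      Real.exp (-action1 (sigmaL d L • secFld L M B + (v : Fld (fine L M)))) = g ((sigmaL d L)⁻¹ • v) := by
    intro v
    have h : sigmaL d L • secFld L M B + (v : Fld (fine L M))
        = sigmaL d L • (secFld L M B + (((sigmaL d L)⁻¹ • v : dirSpace (Qlin L M) (Ax L M)) : Fld (fine L M))) := by
      rw [Submodule.coe_smul, smul_add, smul_smul, mul_inv_cancel₀ hσ0, one_smul]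
    rw [h, action1_sigma_smul]
  have hint : ∫ v : dirSpace (Qlin L M) (Ax L M),
      Real.exp (-action1 (sigmaL d L • secFld L M B + (v : Fld (fine L M))))
        = ∫ v : dirSpace (Qlin L M) (Ax L M), g ((sigmaL d L)⁻¹ • v) :=
    integral_congr_ae (Filter.Eventually.of_forall key)
  rw [hint, Measure.integral_comp_inv_smul, smul_eq_mul, abs_of_pos (pow_pos (sigmaL_pos (d := d) L) _)]

/-- the right-hand side of (1.17) at `k = 1` is the one-step δ-integral of `e^{−S^η}` (on the `fine L M` carrier).
[cite: Balaban1984PropagatorsI, (1.17) p.20] -/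
theorem rt17_one (B : Fld M) :
    rt17 L M 1 B = deltaInt (Qlin L M) (Ax L M) (fun A => Real.exp (-actionEta1 L M A)) B := by
  have hρ : (fun A : Fld (towerM L M 1) => Real.exp (-actionEta L M 1 A))
      = (fun A : Fld (fine L M) => Real.exp (-actionEta1 L M A)) := by
    funext A
    rw [actionEta_one]
  unfold rt17
  rw [hρ, qk_one, axAll_one]
  rfl

/-- **(1.17) at `k = 1`, PROVED**: `((ST)e^{−S})(B) = σ^{dim(N(Q)∩Ax)} · ∫dA δ(B − QA) δ_Ax(A) e^{−S^η(A)}` for every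
`B`, `σ = L^{−(d−2)/2}`, `η = L^{−1}`. [cite: Balaban1984PropagatorsI, (1.17) p.20] -/
theorem iterST_one_eq (B : Fld M) :
    iterST L M 1 (fun A => Real.exp (-action1 A)) B
      = sigmaL d L ^ Module.finrank ℝ (dirSpace (Qlin L M) (Ax L M)) * rt17 L M 1 B := by
  rw [rt17_one, ← scaleDens_rt12_eq]
  rfl

/-- **`Eq117` holds at `k = 1`** with `z^{(1)} = σ^{dim N(Q)∩Ax} > 0`. [cite: Balaban1984PropagatorsI, (1.17) p.20] -/
theorem eq117_one : Eq117 L M 1 :=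
  ⟨sigmaL d L ^ Module.finrank ℝ (dirSpace (Qlin L M) (Ax L M)), pow_pos (sigmaL_pos (d := d) L) _,
    iterST_one_eq L M⟩

end Eq117One

/-! ## §7  (1.14) computed: `(Te^{−S})(B) = Z^{(0)}·exp(−½⟨B, Δ₁B⟩)` with EXPLICIT `Z^{(0)}`, `Δ₁`, reducing the
claim `Eq114` to the positivity of p. 19 on this carrier

«The integral in (1.12) is obviously a Gaussian integral»: the unit-lattice action is `S(A) = ½‖𝒯A‖²` for the linear
curvature map `𝒯 : A ↦ (F_{μν}(x))_{x, μ<ν}` (`curvLin`, `action1_eq_half_norm_sq`), so on the fibre `secFld B + N`,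
`N = N(Q) ∩ Ax`, the integrand is `γ₁(𝒯secFld B + 𝒯v)`; splitting `𝒯secFld B` along the orthogonal projection `R`
onto `𝒯N` (Pythagoras, as in `B5GaussSectC.integral_124`) and translating inside `N` gives
`(Te^{−S})(B) = Z^{(0)}·exp(−½‖(1 − R)𝒯 secFld B‖²)`, `Z^{(0)} = ∫_N γ₁(𝒯v)dv` (`rt12_gauss`), i.e. (1.14) with
`Δ₁ = W^†W`, `W = (1 − R)𝒯∘sec` (`Delta1`, symmetric).  «We will prove later that the quadratic form ⟨∂A, ∂A⟩ is
positive on the subspace …» is exactly what makes `Z^{(0)}` finite and non-zero: `eq114_of_pos`. -/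

section Eq114Gauss

open B5GaussSectC (gaussW gaussW_neg gaussW_sub_comm gaussW_add_of_inner_eq_zero)

/-! ### §7.1  A Gaussian integral over a subspace against a linear map into another space -/

section Generic

variable {E : Type*} [NormedAddCommGroup E] [InnerProductSpace ℝ E] [FiniteDimensional ℝ E]
  [MeasurableSpace E] [BorelSpace E]
variable {E' : Type*} [NormedAddCommGroup E'] [InnerProductSpace ℝ E'] [FiniteDimensional ℝ E']
variable (T : E →ₗ[ℝ] E') (N : Submodule ℝ E)

/-- the image subspace `𝒯N` (for (1.12): the curvatures of the fibre directions). [cite: Balaban1984PropagatorsI, (1.14) p.19] -/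
def imSub : Submodule ℝ E' := N.map T

/-- the orthogonal projection onto `𝒯N`. [cite: Balaban1984PropagatorsI, (1.14) p.19] -/
def Rim : E' →L[ℝ] E' := (imSub T N).starProjection

/-- the Gaussian normalisation `Z = ∫_N γ_α(𝒯x) dx` of the subspace. [cite: Balaban1984PropagatorsI, (1.14) p.19] -/
def ZT (α : ℝ) : ℝ := ∫ x : N, gaussW E' α (T (x : E))

omit [FiniteDimensional ℝ E] [MeasurableSpace E] [BorelSpace E] in
/-- `Rf = 𝒯x₀` for some `x₀ ∈ N`. [cite: Balaban1984PropagatorsI, (1.14) p.19] -/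
theorem exists_preimage_Rim (f : E') : ∃ x ∈ N, T x = Rim T N f := by
  have h : Rim T N f ∈ imSub T N := by
    rw [Rim, Submodule.starProjection_apply]; exact SetLike.coe_mem _
  exact Submodule.mem_map.1 h

omit [FiniteDimensional ℝ E] [MeasurableSpace E] [BorelSpace E] in
/-- Pythagoras: `γ_α(f − 𝒯x) = γ_α(f − Rf)·γ_α(Rf − 𝒯x)` for `x ∈ N`. [cite: Balaban1984PropagatorsI, (1.14) p.19] -/
theorem gaussW_sub_T_split (α : ℝ) (f : E') {x : E} (hx : x ∈ N) :
    gaussW E' α (f - T x) = gaussW E' α (f - Rim T N f) * gaussW E' α (Rim T N f - T x) := by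
  have hsum : f - T x = (f - Rim T N f) + (Rim T N f - T x) := by abel
  have hR : Rim T N f ∈ imSub T N := by
    rw [Rim, Submodule.starProjection_apply]; exact SetLike.coe_mem _
  rw [hsum]
  exact gaussW_add_of_inner_eq_zero α (Submodule.inner_left_of_mem_orthogonal
    (Submodule.sub_mem _ hR (Submodule.mem_map_of_mem hx)) (Submodule.sub_starProjection_mem_orthogonal f))

/-- **the subspace Gaussian integral**: `∫_N γ_α(f − 𝒯x) dx = Z·γ_α(f − Rf)` (split + translation inside `N`).
[cite: Balaban1984PropagatorsI, (1.14) p.19] -/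
theorem integral_gaussW_sub_T (α : ℝ) (f : E') :
    ∫ x : N, gaussW E' α (f - T (x : E)) = ZT T N α * gaussW E' α (f - Rim T N f) := by
  obtain ⟨x₀, hx₀, hTx₀⟩ := exists_preimage_Rim T N f
  have hfun : (fun x : N => gaussW E' α (f - T (x : E))) =
      fun x : N => gaussW E' α (f - Rim T N f) * (fun z : N => gaussW E' α (T (z : E))) (x - ⟨x₀, hx₀⟩) := by
    funext x
    rw [gaussW_sub_T_split T N α f x.2]
    congr 1
    simp only [Submodule.coe_sub, map_sub]
    rw [← hTx₀, gaussW_sub_comm]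
  rw [hfun, integral_const_mul,
    integral_sub_right_eq_self (μ := (volume : Measure N)) (fun z : N => gaussW E' α (T (z : E))) ⟨x₀, hx₀⟩,
    mul_comm]
  rfl

end Generic

/-! ### §7.2  The curvature map and `S(A) = ½‖𝒯A‖²` -/

section Curv

variable {d : ℕ} (N : Fin d → ℕ) [hN : ∀ μ, NeZero (N μ)]

/-- the plaquette functions `(x, μ, ν) ↦ F_{μν}(x)` as a Euclidean space. [cite: Balaban1984PropagatorsI, (1.2) p.18] -/
abbrev Plaq : Type := EuclideanSpace ℝ (Tor N × Fin d × Fin d)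

/-- the curvature of a real field on the plaquettes `μ < ν`: `F_{μν}(x) = A_μ(x) + A_ν(x+e_μ) − A_μ(x+e_ν) − A_ν(x)`
((1.2) at unit lattice factor), `0` on the redundant index pairs `μ ≥ ν`. [cite: Balaban1984PropagatorsI, (1.2) p.18] -/
def curvFun (A : Tor N × Fin d → ℝ) (i : Tor N × Fin d × Fin d) : ℝ :=
  if i.2.1 < i.2.2 then
    A (i.1, i.2.1) + A (i.1 + unitVec N i.2.1, i.2.2) - A (i.1 + unitVec N i.2.2, i.2.1) - A (i.1, i.2.2)
  else 0

/-- **the curvature map `𝒯`** as an `ℝ`-linear map from fields to plaquette functions.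
[cite: Balaban1984PropagatorsI, (1.2) p.18] -/
def curvLin : Fld N →ₗ[ℝ] Plaq N where
  toFun A := WithLp.toLp 2 (curvFun N A)
  map_add' A A' := by
    ext i
    simp only [PiLp.add_apply, curvFun]
    split_ifs <;> ring
  map_smul' c A := by
    ext i
    simp only [PiLp.smul_apply, curvFun, smul_eq_mul, RingHom.id_apply]
    split_ifs <;> ring

omit hN in
/-- `(𝒯A)(x, μ, ν)` is the printed plaquette expression. [cite: Balaban1984PropagatorsI, (1.2) p.18] -/
theorem curvLin_apply (A : Fld N) (i : Tor N × Fin d × Fin d) : curvLin N A i = curvFun N A i := rfl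

/-- DICTIONARY: for `μ < ν`, `(𝒯A)(x,μ,ν)` is the tree's `B5Action121.Fs` of the complexified field (lattice factor 1).
[cite: Balaban1984PropagatorsI, (1.2) p.18] -/
theorem Fs_cplx (A : Fld N) (μ ν : Fin d) (x : Tor N) :
    B5Action121.Fs N 1 (cplx A) μ ν x
      = ((A (x, μ) + A (x + unitVec N μ, ν) - A (x + unitVec N ν, μ) - A (x, ν) : ℝ) : ℂ) := by
  rw [B5Action121.Fs_apply]
  simp only [cplx, one_mul]
  push_cast
  ring

/-- **`S(A) = ½‖𝒯A‖²`**: the unit-lattice action (1.5) of a real field is half the squared Euclidean norm of its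
curvature. [cite: Balaban1984PropagatorsI, (1.5) p.18] -/
theorem action1_eq_half_norm_sq (A : Fld N) : action1 A = 1 / 2 * ‖curvLin N A‖ ^ 2 := by
  rw [action1, actionS, PiLp.norm_sq_eq_of_L2]
  congr 1
  rw [Fintype.sum_prod_type]
  refine Finset.sum_congr rfl fun x _ => ?_
  rw [Fintype.sum_prod_type]
  refine Finset.sum_congr rfl fun μ _ => Finset.sum_congr rfl fun ν _ => ?_
  rw [curvLin_apply, curvFun]
  split_ifs with h
  · rw [one_mul, Fs_cplx, Complex.norm_real, Real.norm_eq_abs, sq_abs]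
  · simp

/-- `e^{−S(A)} = γ₁(𝒯A)`. [cite: Balaban1984PropagatorsI, (1.12) p.19] -/
theorem exp_neg_action1 (A : Fld N) : Real.exp (-action1 A) = gaussW (Plaq N) 1 (curvLin N A) := by
  rw [gaussW, action1_eq_half_norm_sq]
  congr 1
  ring

end Curv

/-! ### §7.3  The section as a linear map, `Z^{(0)}`, `Δ₁`, and (1.14) -/

section Assemble

variable {d : ℕ} (n : ℕ) [NeZero n] (M : Fin d → ℕ) [hM : ∀ μ, NeZero (M μ)]

/-- the axial section `secFld` is linear in `B`. [cite: Balaban1984PropagatorsI, (1.12) p.19] -/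
def secLin : Fld M →ₗ[ℝ] Fld (fine n M) where
  toFun := secFld n M
  map_add' B B' := by
    ext i
    simp only [secFld, PiLp.toLp_apply, PiLp.add_apply]
    split_ifs <;> ring
  map_smul' c B := by
    ext i
    simp only [secFld, PiLp.toLp_apply, PiLp.smul_apply, smul_eq_mul, RingHom.id_apply]
    split_ifs <;> ring

/-- `secLin B = secFld B`. [cite: Balaban1984PropagatorsI, (1.12) p.19] -/
theorem secLin_apply (B : Fld M) : secLin n M B = secFld n M B := rfl

/-- **`Z^{(0)}`** of (1.14), explicitly: `∫_{N(Q)∩Ax} e^{−S(v)} dv = ∫_N γ₁(𝒯v) dv` — *"Z^{(0)} … a normalization factor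
connected with … integration"*; finite and non-zero exactly when `⟨∂A, ∂A⟩` is positive definite on `N(Q)∩Ax` (p. 19).
[cite: Balaban1984PropagatorsI, (1.14) p.19] -/
def Z0 : ℝ := ZT (curvLin (fine n M)) (dirSpace (Qlin n M) (Ax n M)) 1

/-- `Z^{(0)} = ∫_{N} e^{−S(v)} dv`. [cite: Balaban1984PropagatorsI, (1.14) p.19] -/
theorem Z0_eq : Z0 n M = ∫ v : dirSpace (Qlin n M) (Ax n M), Real.exp (-action1 (v : Fld (fine n M))) := by
  rw [Z0, ZT]
  simp_rw [exp_neg_action1]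

/-- the linear map `W = (1 − R)𝒯∘sec : B ↦ (1 − R)𝒯(secFld B)`, `R` the orthogonal projection onto the curvatures of
the fibre directions. [cite: Balaban1984PropagatorsI, (1.14) p.19] -/
def Wmap : Fld M →ₗ[ℝ] Plaq (fine n M) :=
  (LinearMap.id - (Rim (curvLin (fine n M)) (dirSpace (Qlin n M) (Ax n M))).toLinearMap) ∘ₗ
    curvLin (fine n M) ∘ₗ secLin n M

/-- `W B = 𝒯 secFld B − R 𝒯 secFld B`. [cite: Balaban1984PropagatorsI, (1.14) p.19] -/
theorem Wmap_apply (B : Fld M) :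
    Wmap n M B = curvLin (fine n M) (secFld n M B)
      - Rim (curvLin (fine n M)) (dirSpace (Qlin n M) (Ax n M)) (curvLin (fine n M) (secFld n M B)) := rfl

/-- **`Δ₁ = W^†W`** — the operator of the quadratic form `S₁(B) = ½⟨B, Δ₁B⟩` of (1.14), explicitly.
[cite: Balaban1984PropagatorsI, (1.14) p.19] -/
def Delta1 : Fld M →ₗ[ℝ] Fld M := (LinearMap.adjoint (Wmap n M)) ∘ₗ Wmap n M

/-- `Δ₁` is symmetric. [cite: Balaban1984PropagatorsI, (1.14) p.19] -/
theorem Delta1_symm (B B' : Fld M) : inner ℝ (Delta1 n M B) B' = inner ℝ B (Delta1 n M B') := by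
  simp only [Delta1, LinearMap.comp_apply, LinearMap.adjoint_inner_left, LinearMap.adjoint_inner_right]

/-- `⟨B, Δ₁B⟩ = ‖WB‖²`. [cite: Balaban1984PropagatorsI, (1.14) p.19] -/
theorem inner_Delta1 (B : Fld M) : inner ℝ B (Delta1 n M B) = ‖Wmap n M B‖ ^ 2 := by
  rw [Delta1, LinearMap.comp_apply, LinearMap.adjoint_inner_right, real_inner_self_eq_norm_sq]

/-- **(1.14) COMPUTED**: `(Te^{−S})(B) = Z^{(0)} · exp(−½⟨B, Δ₁B⟩)` for every `B`, with the explicit `Z^{(0)}` and `Δ₁`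
above (no positivity needed for the identity itself). [cite: Balaban1984PropagatorsI, (1.14) p.19] -/
theorem rt12_gauss (B : Fld M) : rt12 n M B = Z0 n M * Real.exp (-S1 M (Delta1 n M) B) := by
  rw [rt12, rtT_eq]
  have hfun : (fun v : dirSpace (Qlin n M) (Ax n M) => Real.exp (-action1 (secFld n M B + (v : Fld (fine n M)))))
      = fun v : dirSpace (Qlin n M) (Ax n M) =>
          gaussW (Plaq (fine n M)) 1
            ((-curvLin (fine n M) (secFld n M B)) - curvLin (fine n M) (v : Fld (fine n M))) := by
    funext v
    rw [exp_neg_action1, map_add, ← gaussW_neg]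
    congr 1
    abel
  rw [hfun, integral_gaussW_sub_T (curvLin (fine n M)) (dirSpace (Qlin n M) (Ax n M)) 1, Z0, S1, inner_Delta1,
    Wmap_apply, gaussW, map_neg]
  congr 2
  rw [show -curvLin (fine n M) (secFld n M B) - -(Rim (curvLin (fine n M)) (dirSpace (Qlin n M) (Ax n M)))
      (curvLin (fine n M) (secFld n M B)) = -(curvLin (fine n M) (secFld n M B) - (Rim (curvLin (fine n M))
      (dirSpace (Qlin n M) (Ax n M))) (curvLin (fine n M) (secFld n M B))) by abel, norm_neg]
  ring

/-- **(1.14) from positivity**: if `Z^{(0)} > 0` (⟺ `e^{−S}` integrable over the fibre directions ⟺ the positivity of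
`⟨∂A, ∂A⟩` on `{QA = 0, A axial}` claimed on p. 19 and proved in part II), then `Eq114` holds with `Z^{(0)}` and
`Δ₁ = W^†W`. [cite: Balaban1984PropagatorsI, (1.14) p.19] -/
theorem eq114_of_pos (h : 0 < Z0 n M) : Eq114 n M :=
  ⟨Z0 n M, h, Delta1 n M, Delta1_symm n M, rt12_gauss n M⟩

end Assemble

end Eq114Gauss

/-! ### §7.4  (1.19) at `k = 1` from (1.14): the rescaled Gaussian is a Gaussian -/

section Eq119One

variable {d : ℕ} (L : ℕ) [NeZero L] (M : Fin d → ℕ) [hM : ∀ μ, NeZero (M μ)]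

/-- `S₁` scales quadratically: `S₁(σB) = ½⟨B, (σ²Δ₁)B⟩`. [cite: Balaban1984PropagatorsI, (1.14) p.19] -/
theorem S1_smul (Δ₁ : Fld M →ₗ[ℝ] Fld M) (c : ℝ) (B : Fld M) : S1 M Δ₁ (c • B) = S1 M ((c ^ 2) • Δ₁) B := by
  simp only [S1, map_smul, LinearMap.smul_apply, real_inner_smul_left, real_inner_smul_right]
  ring

/-- **`((ST)e^{−S})(B) = Z^{(0)}·exp(−½⟨B, σ²Δ₁B⟩)`** — (1.19) at `k = 1` COMPUTED: `Z_{1,Ax} = Z^{(0)}` («Z_{k,Ax} =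
Z^{(k−1)}·…·Z^{(0)}» at k = 1) and `Δ_1 = σ²·W^†W`, `σ = L^{−(d−2)/2}`. [cite: Balaban1984PropagatorsI, (1.19) p.20] -/
theorem iterST_one_gauss (B : Fld M) :
    iterST L M 1 (fun A => Real.exp (-action1 A)) B
      = Z0 L M * Real.exp (-S1 M ((sigmaL d L ^ 2) • Delta1 L M) B) := by
  show scaleDens L (rt12 L M) B = _
  rw [scaleDens_apply, rt12_gauss, S1_smul]

/-- **`Eq119` at `k = 1` from positivity** (`Z^{(0)} > 0`). [cite: Balaban1984PropagatorsI, (1.19) p.20] -/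
theorem eq119_one_of_pos (h : 0 < Z0 L M) : Eq119 L M 1 := by
  refine ⟨Z0 L M, h, (sigmaL d L ^ 2) • Delta1 L M, fun B B' => ?_, iterST_one_gauss L M⟩
  simp only [LinearMap.smul_apply, real_inner_smul_left, real_inner_smul_right, Delta1_symm]

end Eq119One

/-! ### §7.5  `Z^{(0)} > 0` from the positivity of p. 19 on this carrier -/

section Positivity

open B5GaussSectC (gaussW gaussW_pos continuous_gaussW)

variable {E : Type*} [NormedAddCommGroup E] [InnerProductSpace ℝ E] [FiniteDimensional ℝ E]
  [MeasurableSpace E] [BorelSpace E]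
variable {E' : Type*} [NormedAddCommGroup E'] [InnerProductSpace ℝ E'] [FiniteDimensional ℝ E']
variable (T : E →ₗ[ℝ] E') (N : Submodule ℝ E)

omit [MeasurableSpace E] [BorelSpace E] [FiniteDimensional ℝ E'] in
/-- coercivity: if `𝒯` is injective on `N` then `m‖x‖² ≤ ‖𝒯x‖²` on `N` for some `m > 0` (compactness of the unit sphere;
the pattern of `B5Hk164Transl.exists_sq_norm_le_cEnergy`). [cite: Balaban1984PropagatorsI, p.19 (claim after (1.13))] -/
theorem exists_sq_norm_le (h : ∀ x ∈ N, T x = 0 → x = 0) :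
    ∃ m : ℝ, 0 < m ∧ ∀ x : N, m * ‖x‖ ^ 2 ≤ ‖T (x : E)‖ ^ 2 := by
  classical
  set q : N → ℝ := fun x => ‖T (x : E)‖ ^ 2 with hq
  have hqc : Continuous q := by
    have : Continuous fun x : N => T (x : E) :=
      (T.continuous_of_finiteDimensional).comp continuous_subtype_val
    exact (continuous_norm.comp this).pow 2
  have hqpos : ∀ x : N, x ≠ 0 → 0 < q x := by
    intro x hx
    have hne : T (x : E) ≠ 0 := by
      intro h0
      apply hx
      exact Subtype.ext (h x x.2 h0)
    simp only [hq]
    positivity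
  have hhom : ∀ (t : ℝ) (x : N), q (t • x) = t ^ 2 * q x := by
    intro t x
    simp only [hq, Submodule.coe_smul, map_smul, norm_smul, mul_pow, Real.norm_eq_abs, sq_abs]
  by_cases hS : (Metric.sphere (0 : N) 1).Nonempty
  · obtain ⟨u₀, hu₀, hmin⟩ := (isCompact_sphere (0 : N) 1).exists_isMinOn hS hqc.continuousOn
    have hu₀ne : u₀ ≠ 0 := by
      intro h0
      rw [h0, Metric.mem_sphere, dist_self] at hu₀
      exact zero_ne_one hu₀
    refine ⟨q u₀, hqpos u₀ hu₀ne, fun x => ?_⟩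
    by_cases hx : x = 0
    · subst hx
      simp [hq]
    · have hnorm : ‖x‖ ≠ 0 := norm_ne_zero_iff.mpr hx
      set u := (‖x‖⁻¹ : ℝ) • x with hu
      have hu1 : u ∈ Metric.sphere (0 : N) 1 := by
        rw [mem_sphere_zero_iff_norm, hu, norm_smul, norm_inv, norm_norm, inv_mul_cancel₀ hnorm]
      have hxu : x = ‖x‖ • u := by
        rw [hu, smul_smul, mul_inv_cancel₀ hnorm, one_smul]
      have hle : q u₀ ≤ q u := hmin hu1
      calc q u₀ * ‖x‖ ^ 2 ≤ q u * ‖x‖ ^ 2 := mul_le_mul_of_nonneg_right hle (sq_nonneg _)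
        _ = q x := by
            conv_rhs => rw [hxu, hhom]
            exact mul_comm _ _
  · refine ⟨1, one_pos, fun x => ?_⟩
    have hx : x = 0 := by
      by_contra hx
      apply hS
      refine ⟨(‖x‖⁻¹ : ℝ) • x, ?_⟩
      rw [mem_sphere_zero_iff_norm, norm_smul, norm_inv, norm_norm, inv_mul_cancel₀ (norm_ne_zero_iff.mpr hx)]
    subst hx
    simp

omit [FiniteDimensional ℝ E'] in
/-- integrability of `x ↦ γ_α(𝒯x)` on `N` when `𝒯` is injective on `N` (`α > 0`).
[cite: Balaban1984PropagatorsI, p.19 (claim after (1.13))] -/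
theorem integrable_gaussW_T (h : ∀ x ∈ N, T x = 0 → x = 0) {α : ℝ} (hα : 0 < α) :
    Integrable (fun x : N => gaussW E' α (T (x : E))) := by
  obtain ⟨m, hm, hle⟩ := exists_sq_norm_le T N h
  have hb : 0 < m / (2 * α) := by positivity
  have hg : Integrable (fun x : N => Real.exp (-(m / (2 * α)) * ‖x‖ ^ 2)) := by
    apply Integrable.of_integral_ne_zero
    rw [GaussianFourier.integral_rexp_neg_mul_sq_norm hb]
    positivity
  refine hg.mono' ?_ ?_
  · have : Continuous fun x : N => T (x : E) :=
      (T.continuous_of_finiteDimensional).comp continuous_subtype_val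
    exact ((continuous_gaussW α).comp this).aestronglyMeasurable
  · refine Filter.Eventually.of_forall fun x => ?_
    rw [Real.norm_eq_abs, abs_of_pos (gaussW_pos α _), gaussW]
    apply Real.exp_le_exp.mpr
    have hx := hle x
    have h2α : (0 : ℝ) ≤ 2 * α := by positivity
    rw [show -(m / (2 * α)) * ‖x‖ ^ 2 = -(m * ‖x‖ ^ 2) / (2 * α) by ring]
    exact div_le_div_of_nonneg_right (neg_le_neg hx) h2α

omit [FiniteDimensional ℝ E'] in
/-- `Z = ∫_N γ_α(𝒯x)dx > 0` when `𝒯` is injective on `N`. [cite: Balaban1984PropagatorsI, p.19 (claim after (1.13))] -/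
theorem ZT_pos_of_injOn (h : ∀ x ∈ N, T x = 0 → x = 0) {α : ℝ} (hα : 0 < α) : 0 < ZT T N α := by
  rw [ZT]
  have hi := integrable_gaussW_T T N h hα
  simp only [gaussW] at hi ⊢
  exact integral_exp_pos hi

end Positivity

section Eq114FromP19

variable {d : ℕ} (n : ℕ) [NeZero n] (M : Fin d → ℕ) [hM : ∀ μ, NeZero (M μ)]

/-- the p. 19 positivity in the form used here: on `{QA = 0, A axial}`, `S(A) = 0 ⇒ A = 0` is the same as
`𝒯A = 0 ⇒ A = 0`. [cite: Balaban1984PropagatorsI, p.19 (claim after (1.13))] -/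
theorem action1_eq_zero_iff {N : Fin d → ℕ} [∀ μ, NeZero (N μ)] (A : Fld N) :
    action1 A = 0 ↔ curvLin N A = 0 := by
  rw [action1_eq_half_norm_sq]
  constructor
  · intro h
    have : ‖curvLin N A‖ ^ 2 = 0 := by linarith
    exact norm_eq_zero.mp (pow_eq_zero_iff two_ne_zero |>.mp this)
  · intro h
    rw [h, norm_zero]
    ring

/-- **`Z^{(0)} > 0` from the positivity claim of p. 19** read on this carrier: *"the quadratic form ⟨∂A, ∂A⟩ is positive on
the subspace of A satisfying QA = 0, A(Γ_{y,x}) = 0"*, i.e. `S(A) = 0 ⇒ A = 0` on `N(Q)∩Ax`.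
[cite: Balaban1984PropagatorsI, p.19 (claim after (1.13))] -/
theorem Z0_pos_of_claimP19 (h19 : ∀ A ∈ dirSpace (Qlin n M) (Ax n M), action1 A = 0 → A = 0) : 0 < Z0 n M := by
  rw [Z0]
  exact ZT_pos_of_injOn (curvLin (fine n M)) (dirSpace (Qlin n M) (Ax n M))
    (fun A hA h0 => h19 A hA ((action1_eq_zero_iff A).mpr h0)) one_pos

/-- **(1.14) from the p. 19 positivity** (part II, Lemma 2.4 — `B5SectAStatements.claimP19_holds` on the sister carrier).
[cite: Balaban1984PropagatorsI, (1.14) p.19] -/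
theorem eq114_of_claimP19 (h19 : ∀ A ∈ dirSpace (Qlin n M) (Ax n M), action1 A = 0 → A = 0) : Eq114 n M :=
  eq114_of_pos n M (Z0_pos_of_claimP19 n M h19)

/-- **(1.19) at k = 1 from the p. 19 positivity**. [cite: Balaban1984PropagatorsI, (1.19) p.20] -/
theorem eq119_one_of_claimP19 (h19 : ∀ A ∈ dirSpace (Qlin n M) (Ax n M), action1 A = 0 → A = 0) :
    Eq119 n M 1 :=
  eq119_one_of_pos n M (Z0_pos_of_claimP19 n M h19)

end Eq114FromP19

/-! ## §8  The p. 19 positivity TRANSFERRED from the `B6Lemma24Torus` carrier: `Z^{(0)} > 0`, (1.14) PROVED (d ≥ 2) -/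

section ClaimP19Torus

open B6TreeGaugePoincare (Cfg curl)
open B6Lemma24Torus (IsPeriodic IsPeriod pbox mem_pbox coarseSites mem_coarseSites faces mem_faces bondsT plaqT
  normSqT d1SqT)
open B6Lemma24PrintedShape (q1 segSum contourSum)
open B6Elimination (block mem_block)
open B6BondElimination (contour mem_contour)

variable {d : ℕ}

/-- the class map `ℤ^d → T` (coordinates mod the periods). [cite: Balaban1984PropagatorsI, (1.1) p.18] -/
def toTor (N : Fin d → ℕ) (z : Fin d → ℤ) : Tor N := fun ν => (z ν : ZMod (N ν))

/-- `toTor` is additive. [cite: Balaban1984PropagatorsI, (1.1) p.18] -/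
theorem toTor_add (N : Fin d → ℕ) (z w : Fin d → ℤ) : toTor N (z + w) = toTor N z + toTor N w := by
  funext ν
  simp [toTor]

/-- `toTor e_μ = e_μ`. [cite: Balaban1984PropagatorsI, (1.1) p.18] -/
theorem toTor_unitVec (N : Fin d → ℕ) (μ : Fin d) : toTor N (B6BondElimination.unitVec μ) = unitVec N μ := by
  funext ν
  by_cases h : ν = μ
  · subst h
    simp [toTor, B6BondElimination.unitVec_apply, unitVec]
  · simp [toTor, B6BondElimination.unitVec_apply, unitVec, h]

/-- `toTor (s e_μ) = s` fine steps. [cite: Balaban1984PropagatorsI, (1.1) p.18] -/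
theorem toTor_smul_unitVec (N : Fin d → ℕ) (μ : Fin d) (s : ℕ) :
    toTor N ((s : ℤ) • B6BondElimination.unitVec μ) = tstep N μ s := by
  funext ν
  simp only [toTor, Pi.smul_apply, B6BondElimination.unitVec_apply, smul_eq_mul, tstep]
  split_ifs <;> simp

/-- a period vector is `0` on the torus. [cite: Balaban1984PropagatorsI, (1.1) p.18] -/
theorem toTor_period (N : Fin d → ℕ) {v : Fin d → ℤ} (hv : IsPeriod N v) : toTor N v = 0 := by
  funext ν
  simp only [toTor, Pi.zero_apply]
  exact (ZMod.intCast_zmod_eq_zero_iff_dvd (v ν) (N ν)).mpr (hv ν)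

/-- **a real torus field read as an `N`-periodic configuration on the unit bonds of `ℤ^d`** (the carrier of
`B6Lemma24Torus` / `B5SectAStatements.ClaimP19`). [cite: Balaban1984PropagatorsI, (1.1) p.18] -/
def liftCfg (N : Fin d → ℕ) (A : Fld N) : Cfg d := fun b => A (toTor N b.1, b.2)

/-- the lifted configuration is periodic. [cite: Balaban1984PropagatorsI, (1.1) p.18] -/
theorem isPeriodic_liftCfg (N : Fin d → ℕ) (A : Fld N) : IsPeriodic N (liftCfg N A) := by
  intro x v ν hv
  simp only [liftCfg, toTor_add, toTor_period N hv, add_zero]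

variable (N : Fin d → ℕ) [hN : ∀ ν, NeZero (N ν)]

/-- sums over the box of representatives are sums over the torus. [cite: Balaban1984PropagatorsI, (1.1) p.18] -/
theorem sum_pbox_toTor (f : Tor N → ℝ) : ∑ z ∈ pbox N, f (toTor N z) = ∑ x : Tor N, f x := by
  refine Finset.sum_nbij' (toTor N) (fun x => fun ν => ((x ν).val : ℤ)) (fun _ _ => Finset.mem_univ _) ?_ ?_ ?_ ?_
  · intro x _
    rw [mem_pbox]
    intro i
    exact ⟨by positivity, by exact_mod_cast ZMod.val_lt (x i)⟩
  · intro z hz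
    rw [mem_pbox] at hz
    funext i
    simp only [toTor, ZMod.val_intCast]
    exact Int.emod_eq_of_lt (hz i).1 (hz i).2
  · intro x _
    funext ν
    simp [toTor]
  · intro z _
    rfl

/-- `‖A‖²_{T₁}` of the lifted configuration is the Euclidean norm of the field. [cite: Balaban1984PropagatorsI, (1.1) p.18] -/
theorem normSqT_liftCfg (A : Fld N) : normSqT N (liftCfg N A) = ‖A‖ ^ 2 := by
  rw [normSqT, bondsT, Finset.sum_product, PiLp.norm_sq_eq_of_L2, Fintype.sum_prod_type,
    ← sum_pbox_toTor N (fun x => ∑ ν, ‖A (x, ν)‖ ^ 2)]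
  refine Finset.sum_congr rfl fun z _ => Finset.sum_congr rfl fun ν _ => ?_
  rw [liftCfg, Real.norm_eq_abs, sq_abs]

omit hN in
/-- the plaquette variable of the lifted configuration is the curvature of the field. [cite: Balaban1984PropagatorsI, (1.2) p.18] -/
theorem curl_liftCfg (A : Fld N) (z : Fin d → ℤ) {j μ : Fin d} (h : j < μ) :
    curl (liftCfg N A) z j μ = curvLin N A (toTor N z, j, μ) := by
  rw [curvLin_apply, curvFun, if_pos h]
  simp only [curl, liftCfg, toTor_add, toTor_unitVec]

/-- `Σ_p |(∂₁B)(p)|²` of the lifted configuration is `‖𝒯A‖² = 2S(A)`. [cite: Balaban1984PropagatorsI, (1.5) p.18] -/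
theorem d1SqT_liftCfg (A : Fld N) : d1SqT N (liftCfg N A) = ‖curvLin N A‖ ^ 2 := by
  rw [d1SqT, plaqT, Finset.sum_filter, Finset.sum_product, PiLp.norm_sq_eq_of_L2, Fintype.sum_prod_type,
    ← sum_pbox_toTor N (fun x => ∑ jμ : Fin d × Fin d, ‖curvLin N A (x, jμ)‖ ^ 2)]
  refine Finset.sum_congr rfl fun z _ => ?_
  rw [Finset.sum_product, Fintype.sum_prod_type]
  refine Finset.sum_congr rfl fun j _ => Finset.sum_congr rfl fun μ _ => ?_
  split_ifs with h
  · rw [curl_liftCfg N A z h, Real.norm_eq_abs, sq_abs]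
  · rw [curvLin_apply, curvFun, if_neg h, norm_zero]
    ring


/-! ### §8.2  Blocks, contours and averages of the lifted configuration -/

variable (L : ℕ) [NeZero L] (M : Fin d → ℕ) [hM : ∀ μ, NeZero (M μ)]

/-- the label in `T_L^{(1)} ≅ Tor M` of a coarse site `y ∈ LZ^d`: `y/L mod M`. [cite: Balaban1984PropagatorsI, (1.6) p.18] -/
def yTor (y : Fin d → ℤ) : Tor M := fun ν => (((y ν) / (L : ℤ) : ℤ) : ZMod (M ν))

omit [NeZero L] hM in
/-- a coarse site of `ℤ^d` is the image `n·y′` of its label. [cite: Balaban1984PropagatorsI, (1.6) p.18] -/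
theorem toTor_coarse {y : Fin d → ℤ} (hy : ∀ i, (L : ℤ) ∣ y i) :
    toTor (fine L M) y = B5Block118.up L M (yTor L M y) := by
  funext ν
  simp only [toTor, B5Block118.up, yTor, B5Block118.upHom_intCast]
  have h := Int.mul_ediv_cancel' (hy ν)
  conv_lhs => rw [← h]
  push_cast
  ring

omit [NeZero L] hM in
/-- block offsets: `toTor (j) = ι j`. [cite: Balaban1984PropagatorsI, (1.6) p.18] -/
theorem toTor_offsets (k : Fin d → Fin L) :
    toTor (fine L M) (fun i => ((k i : ℕ) : ℤ)) = B5Block118.iota L M k := by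
  funext ν
  simp [toTor, B5Block118.iota]

omit [NeZero L] hM in
/-- the point `y + j` of the block `B(y) ⊂ ℤ^d` is the block point `ny′ + j` of the torus.
[cite: Balaban1984PropagatorsI, (1.6) p.18] -/
theorem toTor_block_pt {y : Fin d → ℤ} (hy : ∀ i, (L : ℤ) ∣ y i) (k : Fin d → Fin L) :
    toTor (fine L M) (y + fun i => ((k i : ℕ) : ℤ)) = bpt L M (yTor L M y) k := by
  rw [toTor_add, toTor_coarse L M hy, toTor_offsets, bpt]

/-- the offsets of a point relative to a corner (total function; meaningful on the block). [cite: Balaban1984PropagatorsI, (1.6) p.18] -/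
def offsOf (y x : Fin d → ℤ) : Fin d → Fin L :=
  fun i => ⟨(x i - y i).toNat % L, Nat.mod_lt _ (Nat.pos_of_ne_zero (NeZero.ne L))⟩

omit hM in
/-- on the block the offsets are `x − y`. [cite: Balaban1984PropagatorsI, (1.6) p.18] -/
theorem offsOf_spec {y x : Fin d → ℤ} (hx : x ∈ B6Elimination.block L y) (i : Fin d) : ((offsOf L y x i : ℕ) : ℤ) = x i - y i := by
  obtain ⟨h1, h2⟩ := (mem_block.1 hx) i
  have h3 : (x i - y i).toNat < L := by
    have : x i - y i < L := by linarith
    omega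
  simp only [offsOf, Nat.mod_eq_of_lt h3]
  omega

omit hM in
/-- `y + (x − y) = x` on the block. [cite: Balaban1984PropagatorsI, (1.6) p.18] -/
theorem add_offsOf {y x : Fin d → ℤ} (hx : x ∈ B6Elimination.block L y) : (y + fun i => ((offsOf L y x i : ℕ) : ℤ)) = x := by
  funext i
  rw [Pi.add_apply, offsOf_spec L hx]
  ring

omit [NeZero L] hM in
/-- `y + j` lies in the block and has offsets `j`. [cite: Balaban1984PropagatorsI, (1.6) p.18] -/
theorem add_offsets_mem_block (y : Fin d → ℤ) (k : Fin d → Fin L) : (y + fun i => ((k i : ℕ) : ℤ)) ∈ B6Elimination.block L y := by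
  rw [mem_block]
  intro i
  have := (k i).is_lt
  simp only [Pi.add_apply]
  constructor <;> omega

omit hM in
/-- … and `offsOf` recovers `j`. [cite: Balaban1984PropagatorsI, (1.6) p.18] -/
theorem offsOf_add_offsets (y : Fin d → ℤ) (k : Fin d → Fin L) : offsOf L y (y + fun i => ((k i : ℕ) : ℤ)) = k := by
  funext i
  apply Fin.ext
  have := (k i).is_lt
  simp only [offsOf, Pi.add_apply, add_sub_cancel_left, Int.toNat_natCast, Nat.mod_eq_of_lt this]

omit hM in
/-- sums over a block of `ℤ^d` are sums over block offsets. [cite: Balaban1984PropagatorsI, (1.6) p.18] -/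
theorem sum_block_eq {y : Fin d → ℤ} (hy : ∀ i, (L : ℤ) ∣ y i) (f : Tor (fine L M) → ℝ) :
    ∑ x ∈ B6Elimination.block L y, f (toTor (fine L M) x) = ∑ k : Fin d → Fin L, f (bpt L M (yTor L M y) k) := by
  refine Finset.sum_nbij' (offsOf L y) (fun k => y + fun i => ((k i : ℕ) : ℤ)) (fun _ _ => Finset.mem_univ _)
    (fun k _ => add_offsets_mem_block L y k) (fun x hx => add_offsOf L hx) (fun k _ => offsOf_add_offsets L y k) ?_
  intro x hx
  rw [← toTor_block_pt L M hy, add_offsOf L hx]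

omit hM in
/-- **(1.11) across the bridge**: `(Q₁B)(c)` of the lifted configuration at the coarse bond `c = ⟨y, y + Le_μ⟩` is
`(QA)` of the field at the label of `y`. [cite: Balaban1984PropagatorsI, (1.11) p.19] -/
theorem q1_liftCfg {y : Fin d → ℤ} (hy : ∀ i, (L : ℤ) ∣ y i) (μ : Fin d) (A : Fld (fine L M)) :
    q1 L (liftCfg (fine L M) A) (y, μ) = Qlin L M A (yTor L M y, μ) := by
  rw [Qlin_apply, qFun, q1]
  simp only
  rw [← Finset.mul_sum, one_div]
  congr 1
  have hseg : ∀ x : Fin d → ℤ, segSum L (liftCfg (fine L M) A) x μ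
      = ∑ t : Fin L, A (toTor (fine L M) x + tstep (fine L M) μ t, μ) := by
    intro x
    rw [segSum, ← Fin.sum_univ_eq_sum_range]
    refine Finset.sum_congr rfl fun t _ => ?_
    rw [liftCfg, toTor_add, toTor_smul_unitVec]
  simp_rw [hseg]
  exact sum_block_eq L M hy (fun z => ∑ t : Fin L, A (z + tstep (fine L M) μ t, μ))

/-- the point of `Γ_{y,x}` reached after the coordinates `> ν` are done and coordinate `ν` has advanced by `t`.
[cite: Balaban1984PropagatorsI, (1.7) p.18] -/
def wOf (y x : Fin d → ℤ) (ν : Fin d) (t : ℕ) : Fin d → ℤ :=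
  fun i => if i < ν then y i else if i = ν then y ν + t else x i

omit hM in
/-- the contour point is the block point with offsets `stairPt j ν t`. [cite: Balaban1984PropagatorsI, (1.7) p.18] -/
theorem wOf_eq {y x : Fin d → ℤ} (hx : x ∈ B6Elimination.block L y) (ν : Fin d) (t : Fin L) :
    wOf y x ν t = y + fun i => ((stairPt L (offsOf L y x) ν t i : ℕ) : ℤ) := by
  funext i
  simp only [wOf, stairPt, Pi.add_apply]
  by_cases h1 : i < ν
  · have h2 : ¬ ν < i := lt_asymm h1
    have h3 : i ≠ ν := ne_of_lt h1
    simp [h1, h2, h3]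
  · by_cases h3 : i = ν
    · subst h3
      simp
    · have h2 : ν < i := lt_of_le_of_ne (not_lt.mp h1) (Ne.symm h3)
      simp only [h1, h3, h2, if_true, if_false]
      rw [offsOf_spec L hx]
      ring

omit hM in
/-- **(1.7)/(1.10) across the bridge**: the contour sum `B(Γ_{y,x})` of the lifted configuration (the β/B6 finset
contour `B6BondElimination.contour`) is the staircase sum `axSum` of the field. [cite: Balaban1984PropagatorsI, (1.7) p.18] -/
theorem contourSum_liftCfg {y x : Fin d → ℤ} (hy : ∀ i, (L : ℤ) ∣ y i) (hx : x ∈ B6Elimination.block L y) (A : Fld (fine L M)) :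
    contourSum L (liftCfg (fine L M) A) y x = axSum L M A (yTor L M y) (offsOf L y x) := by
  have hL : 0 < L := Nat.pos_of_ne_zero (NeZero.ne L)
  set j := offsOf L y x with hj
  have hjspec : ∀ i, ((j i : ℕ) : ℤ) = x i - y i := fun i => offsOf_spec L hx i
  -- the right-hand side as a sum over the filtered index set
  have hrhs : axSum L M A (yTor L M y) j
      = ∑ p ∈ (Finset.univ : Finset (Fin d × Fin L)).filter (fun p => (p.2 : ℕ) < (j p.1 : ℕ)),
          A (bpt L M (yTor L M y) (stairPt L j p.1 p.2), p.1) := by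
    rw [axSum, Finset.sum_filter, Fintype.sum_prod_type]
    refine Finset.sum_congr rfl fun ν _ => Finset.sum_congr rfl fun t _ => ?_
    split_ifs <;> simp
  rw [hrhs, contourSum]
  symm
  refine Finset.sum_nbij' (fun p => (wOf y x p.1 p.2, p.1))
    (fun b => (b.2, ⟨(b.1 b.2 - y b.2).toNat % L, Nat.mod_lt _ hL⟩)) ?_ ?_ ?_ ?_ ?_
  · -- into the contour
    rintro ⟨ν, t⟩ hp
    simp only [Finset.mem_filter, Finset.mem_univ, true_and] at hp
    rw [mem_contour]
    refine ⟨?_, ?_, ?_, ?_⟩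
    · rw [mem_block]
      intro i
      simp only [wOf]
      obtain ⟨hx1, hx2⟩ := (mem_block.1 hx) i
      have hjν := hjspec ν
      have := t.is_lt
      split_ifs with h1 h2
      · constructor <;> omega
      · subst h2; constructor <;> omega
      · constructor <;> omega
    · intro i hi
      simp [wOf, hi]
    · intro i hi
      have h1 : ¬ i < ν := lt_asymm hi
      have h2 : i ≠ ν := ne_of_gt hi
      simp [wOf, h1, h2]
    · simp only [wOf, lt_irrefl, if_false, if_true]
      have hjν := hjspec ν
      omega
  · -- back into the index set
    rintro ⟨w, ν⟩ hb
    obtain ⟨hw, -, -, hlt⟩ := mem_contour.1 hb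
    dsimp only at hw hlt
    simp only [Finset.mem_filter, Finset.mem_univ, true_and]
    obtain ⟨hw1, hw2⟩ := (mem_block.1 hw) ν
    have hjν := hjspec ν
    have h3 : (w ν - y ν).toNat < L := by omega
    rw [Nat.mod_eq_of_lt h3]
    omega
  · -- left inverse
    rintro ⟨ν, t⟩ hp
    simp only [wOf, lt_irrefl, if_false, if_true, add_sub_cancel_left, Int.toNat_natCast,
      Nat.mod_eq_of_lt t.is_lt]
  · -- right inverse
    rintro ⟨w, ν⟩ hb
    obtain ⟨hw, hlo, hhi, hlt⟩ := mem_contour.1 hb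
    dsimp only at hw hlo hhi hlt
    obtain ⟨hw1, hw2⟩ := (mem_block.1 hw) ν
    have h3 : (w ν - y ν).toNat < L := by omega
    ext i
    · simp only [wOf]
      split_ifs with h1 h2
      · exact (hlo i h1).symm
      · subst h2
        rw [Nat.mod_eq_of_lt h3]
        omega
      · exact (hhi i (lt_of_le_of_ne (not_lt.mp h1) (Ne.symm h2))).symm
    · rfl
  · -- values
    rintro ⟨ν, t⟩ hp
    simp only
    rw [liftCfg, wOf_eq L hx, toTor_block_pt L M hy]


/-! ### §8.3  Claim p. 19 on the torus-field carrier; `Z^{(0)} > 0`; (1.14) and (1.19) at `k = 1` PROVED (`d ≥ 2`) -/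

/-- **Claim p. 19 on the carrier of this file** (d ≥ 2): a real field on `T_η`, `η = L⁻¹`, in the axial gauge
(1.10) with `QA = 0` and `S(A) = 0` vanishes — `B5SectAStatements.claimP19_holds` (the `B6Lemma24Torus` periodic
configurations on `ℤ^d`) transported along `liftCfg`. [cite: Balaban1984PropagatorsI, p.19 (claim after (1.13))] -/
theorem claimP19_tor (hd : 2 ≤ d) : ∀ A ∈ dirSpace (Qlin L M) (Ax L M), action1 A = 0 → A = 0 := by
  intro A hA hS
  have hL : 1 ≤ L := Nat.one_le_iff_ne_zero.mpr (NeZero.ne L)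
  have hMpos : ∀ i, 0 < fine L M i := fun i => Nat.pos_of_ne_zero (NeZero.ne _)
  have hLM : ∀ i, L ∣ fine L M i := fun i => ⟨M i, rfl⟩
  obtain ⟨hker, hAx⟩ := Submodule.mem_inf.1 hA
  rw [LinearMap.mem_ker] at hker
  rw [mem_Ax_iff] at hAx
  by_contra hne
  have hpos : 0 < normSqT (fine L M) (liftCfg (fine L M) A) := by
    rw [normSqT_liftCfg]
    exact pow_pos (norm_pos_iff.mpr hne) 2
  have hAx' : ∀ y ∈ coarseSites L (fine L M), ∀ x ∈ B6Elimination.block L y,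
      contourSum L (liftCfg (fine L M) A) y x = 0 := by
    intro y hy x hx
    rw [contourSum_liftCfg L M (mem_coarseSites.1 hy).2 hx]
    exact hAx _ _
  have hQ : ∀ c ∈ faces L (fine L M), q1 L (liftCfg (fine L M) A) c = 0 := by
    rintro ⟨y, μ⟩ hc
    have hy := (mem_coarseSites.1 (mem_faces.1 hc)).2
    rw [q1_liftCfg L M hy μ A, hker]
    rfl
  have h := B5SectAStatements.claimP19_holds hd hL hMpos hLM (liftCfg (fine L M) A) (isPeriodic_liftCfg _ A)
    hAx' hQ hpos
  rw [d1SqT_liftCfg, (action1_eq_zero_iff A).1 hS, norm_zero] at h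
  norm_num at h

/-- **`Z^{(0)} > 0`** (d ≥ 2). [cite: Balaban1984PropagatorsI, (1.14) p.19] -/
theorem Z0_pos (hd : 2 ≤ d) : 0 < Z0 L M :=
  Z0_pos_of_claimP19 L M (claimP19_tor L M hd)

/-- **(1.14) PROVED** for every `d ≥ 2`, every `L ≥ 1` and every torus: the one-step density (1.12) is the Gaussian
`Z^{(0)} exp(−½⟨B, Δ^{(1)}B⟩)` with `Z^{(0)} > 0` and `Δ^{(1)} = W†W` symmetric (explicit: `Z0`, `Delta1`).
[cite: Balaban1984PropagatorsI, (1.14) p.19] -/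
theorem eq114_holds (hd : 2 ≤ d) : Eq114 L M :=
  eq114_of_claimP19 L M (claimP19_tor L M hd)

/-- **(1.19) at `k = 1` PROVED** (d ≥ 2): `(T_{1,L} exp(−S))(B) = Z^{(0)} exp(−½⟨B, σ_L² Δ^{(1)} B⟩)`.
[cite: Balaban1984PropagatorsI, (1.19) p.20] -/
theorem eq119_one_holds (hd : 2 ≤ d) : Eq119 L M 1 :=
  eq119_one_of_claimP19 L M (claimP19_tor L M hd)

end ClaimP19Torus

/-! ## §9  The δ-calculus of (1.16)–(1.17)

### §9.1  (1.16): «∫dB δ(C − QB)δ_Ax(B) ∫dA δ(B − QA)δ_Ax(A)ρ(A) = z ∫dA δ(C − Q₂A)δ_Ax(QA)δ_Ax(A)ρ(A)» — the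
composition of two δ-integrals of linear constraints is the δ-integral of the composite constraint, up to a
numerical (Jacobian) factor -/

section Compose

open MeasureTheory.Measure
open scoped NNReal ENNReal

variable {E : Type*} [NormedAddCommGroup E] [InnerProductSpace ℝ E] [FiniteDimensional ℝ E]
  [MeasurableSpace E] [BorelSpace E]
variable {F : Type*} [NormedAddCommGroup F] [InnerProductSpace ℝ F] [FiniteDimensional ℝ F]
  [MeasurableSpace F] [BorelSpace F]
variable {F' : Type*} [AddCommGroup F'] [Module ℝ F']
variable (C : E →ₗ[ℝ] F) (G : Submodule ℝ E) (C' : F →ₗ[ℝ] F') (G' : Submodule ℝ F)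

omit [FiniteDimensional ℝ E] [MeasurableSpace E] [BorelSpace E] [FiniteDimensional ℝ F] [MeasurableSpace F]
  [BorelSpace F] in
/-- the support of `δ_{G'}(CA)·δ_G(A)`: `G ⊓ C⁻¹G'` (for (1.16): `{A axial} ∩ {QA axial}`).
[cite: Balaban1984PropagatorsI, (1.16) p.20] -/
def compSub (C : E →ₗ[ℝ] F) (G : Submodule ℝ E) (G' : Submodule ℝ F) : Submodule ℝ E := G ⊓ G'.comap C

omit [FiniteDimensional ℝ E] [MeasurableSpace E] [BorelSpace E] [FiniteDimensional ℝ F] [MeasurableSpace F]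
  [BorelSpace F] in
/-- membership in the composite support. [cite: Balaban1984PropagatorsI, (1.16) p.20] -/
theorem mem_compSub_iff (C : E →ₗ[ℝ] F) (G : Submodule ℝ E) (G' : Submodule ℝ F) (A : E) :
    A ∈ compSub C G G' ↔ A ∈ G ∧ C A ∈ G' := by
  rw [compSub, Submodule.mem_inf, Submodule.mem_comap]

variable {C G}
variable (s : F →ₗ[ℝ] E) (hsC : ∀ B, C (s B) = B) (hsG : ∀ B, s B ∈ G)

/-- the splitting map `(v′, v) ↦ s v′ + v` of the composite direction space (raw, `E`-valued).
[cite: Balaban1984PropagatorsI, (1.16) p.20] -/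
def splitRaw : (dirSpace C' G' × dirSpace C G) →ₗ[ℝ] E :=
  s ∘ₗ (dirSpace C' G').subtype ∘ₗ LinearMap.fst ℝ _ _ + (dirSpace C G).subtype ∘ₗ LinearMap.snd ℝ _ _

omit [FiniteDimensional ℝ E] [MeasurableSpace E] [BorelSpace E] [FiniteDimensional ℝ F] [MeasurableSpace F]
  [BorelSpace F] in
/-- the splitting map, pointwise. [cite: Balaban1984PropagatorsI, (1.16) p.20] -/
theorem splitRaw_apply (p : dirSpace C' G' × dirSpace C G) :
    splitRaw C' G' s p = s (p.1 : F) + (p.2 : E) := rfl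

include hsC hsG in
omit [FiniteDimensional ℝ E] [MeasurableSpace E] [BorelSpace E] [FiniteDimensional ℝ F] [MeasurableSpace F]
  [BorelSpace F] in
/-- the splitting map lands in the composite direction space. [cite: Balaban1984PropagatorsI, (1.16) p.20] -/
theorem splitRaw_mem (p : dirSpace C' G' × dirSpace C G) :
    splitRaw C' G' s p ∈ dirSpace (C' ∘ₗ C) (compSub C G G') := by
  obtain ⟨v', v⟩ := p
  have hv' := (mem_dirSpace_iff (v' : F)).1 v'.2
  have hv := (mem_dirSpace_iff (v : E)).1 v.2
  rw [splitRaw_apply, mem_dirSpace_iff, mem_compSub_iff]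
  have hC : C (s (v' : F) + (v : E)) = (v' : F) := by rw [map_add, hsC, hv.1, add_zero]
  refine ⟨?_, G.add_mem (hsG _) hv.2, ?_⟩
  · rw [LinearMap.comp_apply, hC, hv'.1]
  · rw [hC]; exact hv'.2

/-- the splitting map `N(C′)∩G′ × N(C)∩G → N(C′C) ∩ (G ⊓ C⁻¹G′)`. [cite: Balaban1984PropagatorsI, (1.16) p.20] -/
def splitMap : (dirSpace C' G' × dirSpace C G) →ₗ[ℝ] dirSpace (C' ∘ₗ C) (compSub C G G') :=
  (splitRaw C' G' s).codRestrict _ (splitRaw_mem C' G' s hsC hsG)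

omit [FiniteDimensional ℝ E] [MeasurableSpace E] [BorelSpace E] [FiniteDimensional ℝ F] [MeasurableSpace F]
  [BorelSpace F] in
/-- the splitting map into the composite direction space, pointwise. [cite: Balaban1984PropagatorsI, (1.16) p.20] -/
theorem splitMap_coe (p : dirSpace C' G' × dirSpace C G) :
    ((splitMap C' G' s hsC hsG p : dirSpace (C' ∘ₗ C) (compSub C G G')) : E) = s (p.1 : F) + (p.2 : E) := rfl

omit [FiniteDimensional ℝ E] [MeasurableSpace E] [BorelSpace E] [FiniteDimensional ℝ F] [MeasurableSpace F]
  [BorelSpace F] in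
/-- the splitting map is a bijection. [cite: Balaban1984PropagatorsI, (1.16) p.20] -/
theorem splitMap_bijective : Function.Bijective (splitMap C' G' s hsC hsG) := by
  constructor
  · rw [← LinearMap.ker_eq_bot, LinearMap.ker_eq_bot']
    rintro ⟨v', v⟩ h
    have h' := congrArg (fun w : dirSpace (C' ∘ₗ C) (compSub C G G') => (w : E)) h
    simp only [splitMap_coe, Submodule.coe_zero] at h'
    have hv := (mem_dirSpace_iff (v : E)).1 v.2
    have h1 : (v' : F) = 0 := by
      have := congrArg C h'
      rwa [map_add, hsC, hv.1, add_zero, map_zero] at this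
    have h2 : (v : E) = 0 := by rwa [h1, map_zero, zero_add] at h'
    ext <;> simp [h1, h2]
  · intro w
    have hw := (mem_dirSpace_iff (w : E)).1 w.2
    have hwG := (mem_compSub_iff C G G' (w : E)).1 hw.2
    have h1 : C (w : E) ∈ dirSpace C' G' := by
      rw [mem_dirSpace_iff]
      exact ⟨by simpa using hw.1, hwG.2⟩
    have h2 : (w : E) - s (C (w : E)) ∈ dirSpace C G := by
      rw [mem_dirSpace_iff]
      refine ⟨by rw [map_sub, hsC, sub_self], G.sub_mem hwG.1 (hsG _)⟩
    refine ⟨(⟨C (w : E), h1⟩, ⟨(w : E) - s (C (w : E)), h2⟩), ?_⟩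
    apply Subtype.ext
    rw [splitMap_coe]
    simp

/-- the splitting as a continuous linear equivalence. [cite: Balaban1984PropagatorsI, (1.16) p.20] -/
noncomputable def splitEquiv : (dirSpace C' G' × dirSpace C G) ≃L[ℝ] dirSpace (C' ∘ₗ C) (compSub C G G') :=
  (LinearEquiv.ofBijective (splitMap C' G' s hsC hsG) (splitMap_bijective C' G' s hsC hsG)).toContinuousLinearEquiv

omit [MeasurableSpace E] [BorelSpace E] [MeasurableSpace F] [BorelSpace F] in
/-- the splitting equivalence, pointwise. [cite: Balaban1984PropagatorsI, (1.16) p.20] -/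
theorem splitEquiv_coe (p : dirSpace C' G' × dirSpace C G) :
    ((splitEquiv C' G' s hsC hsG p : dirSpace (C' ∘ₗ C) (compSub C G G')) : E) = s (p.1 : F) + (p.2 : E) := rfl

/-- **the Jacobian**: the splitting carries the product of the Euclidean volumes to a positive multiple of the
Euclidean volume of the composite direction space. [cite: Balaban1984PropagatorsI, (1.16) p.20] -/
theorem exists_map_splitEquiv :
    ∃ c : ℝ≥0, 0 < c ∧ Measure.map (splitEquiv C' G' s hsC hsG) volume
      = c • (volume : Measure (dirSpace (C' ∘ₗ C) (compSub C G G'))) := by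
  haveI : IsAddHaarMeasure (volume : Measure (dirSpace C' G' × dirSpace C G)) := by
    rw [volume_eq_prod]; infer_instance
  haveI : IsAddHaarMeasure (Measure.map (splitEquiv C' G' s hsC hsG)
      (volume : Measure (dirSpace C' G' × dirSpace C G))) :=
    (splitEquiv C' G' s hsC hsG).isAddHaarMeasure_map _
  exact ⟨_, addHaarScalarFactor_pos_of_isAddHaarMeasure _ _, isAddLeftInvariant_eq_smul _ _⟩

include hsC hsG in
omit [MeasurableSpace F] [BorelSpace F] in
/-- the inner δ-integral, read along a translate of the outer direction space, is an iterated integral over the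
splitting. [cite: Balaban1984PropagatorsI, (1.16) p.20] -/
theorem deltaInt_inner_eq (ρ : E → ℝ) (A' : F) (v' : dirSpace C' G') :
    deltaInt C G ρ (A' + (v' : F))
      = ∫ v : dirSpace C G, ρ (s A' + ((splitEquiv C' G' s hsC hsG (v', v) : dirSpace (C' ∘ₗ C) (compSub C G G')) : E)) := by
  rw [deltaInt_eq ρ (A := s (A' + (v' : F))) ⟨hsC _, hsG _⟩]
  refine integral_congr_ae (Filter.Eventually.of_forall fun v => ?_)
  simp only [splitEquiv_coe, map_add, add_assoc]

/-- integrability along the composite direction space transfers to the splitting (product) coordinates.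
[cite: Balaban1984PropagatorsI, (1.16) p.20] -/
theorem integrable_comp_splitEquiv {g : dirSpace (C' ∘ₗ C) (compSub C G G') → ℝ} (hg : Integrable g) :
    Integrable (fun p : dirSpace C' G' × dirSpace C G => g (splitEquiv C' G' s hsC hsG p))
      ((volume : Measure (dirSpace C' G')).prod volume) := by
  obtain ⟨c, hc, hmap⟩ := exists_map_splitEquiv C' G' s hsC hsG
  set Φ := splitEquiv C' G' s hsC hsG with hΦ
  let Φm := Φ.toHomeomorph.toMeasurableEquiv
  have hΦm : (Φm : dirSpace C' G' × dirSpace C G → _) = Φ := rfl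
  rw [← volume_eq_prod]
  have h1 : Integrable g (Measure.map Φm volume) := by
    rw [hΦm, hmap]
    exact (integrable_smul_measure (by exact_mod_cast hc.ne') ENNReal.coe_ne_top).2 hg
  exact (integrable_map_equiv Φm g).1 h1

include hsC hsG in
/-- **integrability is inherited by the inner δ-integral**: if `ρ` is integrable along the composite fibres then
`B ↦ ∫dA δ(B − CA)δ_G(A)ρ(A)` is integrable along the outer fibres (Fubini). [cite: Balaban1984PropagatorsI, (1.16) p.20] -/
theorem integrable_deltaInt_shift (ρ : E → ℝ)
    (hρ : ∀ A : E, Integrable (fun w : dirSpace (C' ∘ₗ C) (compSub C G G') => ρ (A + (w : E)))) (A' : F) :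
    Integrable (fun v' : dirSpace C' G' => deltaInt C G ρ (A' + (v' : F))) := by
  have h := (integrable_comp_splitEquiv C' G' s hsC hsG (hρ (s A'))).integral_prod_left
  refine h.congr (Filter.Eventually.of_forall fun v' => ?_)
  simp only
  rw [deltaInt_inner_eq C' G' s hsC hsG ρ A' v']

include hsC hsG in
/-- **(1.16), the δ-calculus step** «∫dB δ(C − QB) δ_Ax(B) (Tρ)(B) = z·∫dA δ(C − Q₂A) δ_Ax(QA) δ_Ax(A) ρ(A)»: composing
two δ-integrals of linear constraints (the inner constraint `C` admitting a linear section `s` inside `G`, as `Q`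
does by the axial section of §2b) gives the δ-integral of the composite constraint `C′C` on the support
`G ⊓ C⁻¹G′`, up to a positive numerical factor independent of the density and of the point, for every density
integrable along the composite fibres. [cite: Balaban1984PropagatorsI, (1.16) p.20] -/
theorem deltaInt_comp : ∃ c : ℝ, 0 < c ∧ ∀ (ρ : E → ℝ) (B' : F'),
    (∀ A : E, Integrable (fun w : dirSpace (C' ∘ₗ C) (compSub C G G') => ρ (A + (w : E)))) →
    deltaInt C' G' (deltaInt C G ρ) B' = c * deltaInt (C' ∘ₗ C) (compSub C G G') ρ B' := by
  obtain ⟨c, hc, hmap⟩ := exists_map_splitEquiv C' G' s hsC hsG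
  refine ⟨c, NNReal.coe_pos.2 hc, fun ρ B' hρ => ?_⟩
  set Φ := splitEquiv C' G' s hsC hsG with hΦ
  by_cases hne : (fibre C' G' B').Nonempty
  · obtain ⟨A', hA'⟩ := hne
    have hA0 : s A' ∈ fibre (C' ∘ₗ C) (compSub C G G') B' := by
      rw [mem_fibre_iff, mem_compSub_iff, LinearMap.comp_apply, hsC]
      exact ⟨hA'.1, hsG _, hA'.2⟩
    rw [deltaInt_eq _ hA', deltaInt_eq _ hA0]
    set g : dirSpace (C' ∘ₗ C) (compSub C G G') → ℝ := fun w => ρ (s A' + (w : E)) with hg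
    have hinner : ∀ v' : dirSpace C' G',
        deltaInt C G ρ (A' + (v' : F)) = ∫ v : dirSpace C G, g (Φ (v', v)) := by
      intro v'
      rw [deltaInt_eq ρ (A := s (A' + (v' : F))) ⟨hsC _, hsG _⟩]
      refine integral_congr_ae (Filter.Eventually.of_forall fun v => ?_)
      simp only [hg, hΦ, splitEquiv_coe, map_add, add_assoc]
    simp_rw [hinner]
    have hgi : Integrable g volume := hρ (s A')
    let Φm := Φ.toHomeomorph.toMeasurableEquiv
    have hΦm : (Φm : dirSpace C' G' × dirSpace C G → _) = Φ := rfl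
    have hgΦ : Integrable (fun p : dirSpace C' G' × dirSpace C G => g (Φ p))
        ((volume : Measure (dirSpace C' G')).prod volume) := by
      rw [← volume_eq_prod]
      have h1 : Integrable g (Measure.map Φm volume) := by
        rw [hΦm, hmap]
        exact (integrable_smul_measure (by exact_mod_cast hc.ne') ENNReal.coe_ne_top).2 hgi
      exact (integrable_map_equiv Φm g).1 h1
    calc ∫ v' : dirSpace C' G', ∫ v : dirSpace C G, g (Φ (v', v))
        = ∫ p : dirSpace C' G' × dirSpace C G, g (Φ p) ∂((volume : Measure (dirSpace C' G')).prod volume) :=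
          (integral_prod _ hgΦ).symm
      _ = ∫ p : dirSpace C' G' × dirSpace C G, g (Φm p) := by rw [← volume_eq_prod, hΦm]
      _ = ∫ w, g w ∂(Measure.map Φm volume) := (integral_map_equiv Φm g).symm
      _ = c * ∫ w, g w := by rw [hΦm, hmap, integral_smul_nnreal_measure, NNReal.smul_def, smul_eq_mul]
  · have hne' : ¬ (fibre (C' ∘ₗ C) (compSub C G G') B').Nonempty := by
      rintro ⟨A, hA⟩
      rw [mem_fibre_iff, mem_compSub_iff] at hA
      exact hne ⟨C A, hA.1, hA.2.2⟩
    rw [deltaInt_of_isEmpty _ hne, deltaInt_of_isEmpty _ hne', mul_zero]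

end Compose

/-! ### §9.2  Dilations: `∫dA δ(cB − CA)δ_G(A)ρ(A) = c^{dim N} ∫dA δ(B − CA)δ_G(A)ρ(cA)` -/

section Dilate

variable {E : Type*} [NormedAddCommGroup E] [InnerProductSpace ℝ E] [FiniteDimensional ℝ E]
  [MeasurableSpace E] [BorelSpace E]
variable {F : Type*} [AddCommGroup F] [Module ℝ F]

omit [FiniteDimensional ℝ E] [MeasurableSpace E] [BorelSpace E] in
/-- dilations act on fibres. [cite: Balaban1984PropagatorsI, (1.17) p.20] -/
theorem smul_mem_fibre' {C : E →ₗ[ℝ] F} {G : Submodule ℝ E} (c : ℝ) {B : F} {A : E} (hA : A ∈ fibre C G B) :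
    c • A ∈ fibre C G (c • B) :=
  ⟨by rw [map_smul, hA.1], G.smul_mem c hA.2⟩

/-- **the scaling factors «coming from scaling transformations»**: evaluating a δ-integral at a dilated point is the
δ-integral of the dilated density times `c^{dim(N(C)∩G)}`. [cite: Balaban1984PropagatorsI, (1.17) p.20] -/
theorem deltaInt_smul_pt (C : E →ₗ[ℝ] F) (G : Submodule ℝ E) (ρ : E → ℝ) {c : ℝ} (hc : 0 < c) (B : F) :
    deltaInt C G ρ (c • B)
      = c ^ Module.finrank ℝ (dirSpace C G) * deltaInt C G (fun A => ρ (c • A)) B := by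
  have hc0 : c ≠ 0 := hc.ne'
  by_cases hne : (fibre C G B).Nonempty
  · obtain ⟨A, hA⟩ := hne
    rw [deltaInt_eq _ (smul_mem_fibre' c hA), deltaInt_eq _ hA]
    set g : dirSpace C G → ℝ := fun w => ρ (c • (A + (w : E))) with hg
    have key : ∀ v : dirSpace C G, ρ (c • A + (v : E)) = g (c⁻¹ • v) := by
      intro v
      have h : c • A + (v : E) = c • (A + (((c⁻¹ • v : dirSpace C G)) : E)) := by
        rw [Submodule.coe_smul, smul_add, smul_smul, mul_inv_cancel₀ hc0, one_smul]
      rw [h]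
    rw [integral_congr_ae (Filter.Eventually.of_forall key), Measure.integral_comp_inv_smul, smul_eq_mul,
      abs_of_pos (pow_pos hc _)]
  · have hne' : ¬ (fibre C G (c • B)).Nonempty := by
      rintro ⟨A, hA⟩
      refine hne ⟨c⁻¹ • A, ?_⟩
      have h := smul_mem_fibre' c⁻¹ hA
      rwa [smul_smul, inv_mul_cancel₀ hc0, one_smul] at h
    rw [deltaInt_of_isEmpty _ hne, deltaInt_of_isEmpty _ hne', mul_zero]

/-- the δ-integral over the ZERO direction space (no constraint directions: `C` injective on `G`) is evaluation —
the case `k = 0` of (1.17), `(ST)⁰ρ = ρ`. [cite: Balaban1984PropagatorsI, (1.17) p.20] -/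
theorem deltaInt_of_dirSpace_eq_bot {C : E →ₗ[ℝ] F} {G : Submodule ℝ E} (h : dirSpace C G = ⊥) (ρ : E → ℝ)
    {B : F} {A : E} (hA : A ∈ fibre C G B) : deltaInt C G ρ B = ρ A := by
  rw [deltaInt_eq ρ hA]
  haveI : Subsingleton (dirSpace C G) := by
    rw [h]; infer_instance
  have hw : ∀ w : dirSpace C G, ρ (A + (w : E)) = ρ A := by
    intro w
    rw [Subsingleton.elim w 0, Submodule.coe_zero, add_zero]
  simp_rw [hw]
  rw [integral_const, smul_eq_mul]
  have hvol : (volume : Measure (dirSpace C G)) Set.univ = 1 := by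
    set b := (stdOrthonormalBasis ℝ (dirSpace C G)).toBasis with hb
    rw [← (stdOrthonormalBasis ℝ (dirSpace C G)).addHaar_eq_volume]
    have hp : _root_.parallelepiped b = Set.univ :=
      Subsingleton.eq_univ_of_nonempty (b.parallelepiped.interior_nonempty.mono interior_subset)
    rw [← hb, ← hp]
    exact b.addHaar_self
  rw [Measure.real, hvol, ENNReal.toReal_one, one_mul]

end Dilate


/-! ### §9.3  Flat fields average to flat fields: `∂A = 0 ⇒ ∂(QA) = 0` (discrete Stokes on the `L × L` squares) -/

section Stokes

variable {d : ℕ} (N : Fin d → ℕ) [hN : ∀ μ, NeZero (N μ)]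

omit hN in
/-- **discrete Stokes** for the `n × n` square at `x` in the `μν`-plane: the sum of the plaquette variables (1.2) is
the holonomy along the boundary. [cite: Balaban1984PropagatorsI, (1.2) p.18] -/
theorem square_stokes (A : Tor N × Fin d → ℝ) (x : Tor N) {μ ν : Fin d} (hμν : μ < ν) (n : ℕ) :
    ∑ a ∈ Finset.range n, ∑ b ∈ Finset.range n, curvFun N A (x + tstep N μ a + tstep N ν b, μ, ν)
      = (∑ t ∈ Finset.range n, A (x + tstep N μ t, μ))
          + (∑ t ∈ Finset.range n, A (x + tstep N μ n + tstep N ν t, ν))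
          - (∑ t ∈ Finset.range n, A (x + tstep N ν n + tstep N μ t, μ))
          - ∑ t ∈ Finset.range n, A (x + tstep N ν t, ν) := by
  set f : ℕ → ℕ → ℝ := fun a b => A (x + tstep N μ a + tstep N ν b, μ) with hf
  set g : ℕ → ℕ → ℝ := fun a b => A (x + tstep N μ a + tstep N ν b, ν) with hg
  have hcurv : ∀ a b, curvFun N A (x + tstep N μ a + tstep N ν b, μ, ν)
      = (f a b - f a (b + 1)) + (g (a + 1) b - g a b) := by
    intro a b
    simp only [hf, hg, curvFun, if_pos hμν, B5Block118.tstep_succ]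
    have h1 : x + tstep N μ a + tstep N ν b + unitVec N ν = x + tstep N μ a + (tstep N ν b + unitVec N ν) := by
      abel
    have h2 : x + tstep N μ a + tstep N ν b + unitVec N μ = x + (tstep N μ a + unitVec N μ) + tstep N ν b := by
      abel
    rw [h1, h2]
    ring
  simp_rw [hcurv, Finset.sum_add_distrib]
  have hS1 : ∑ a ∈ Finset.range n, ∑ b ∈ Finset.range n, (f a b - f a (b + 1))
      = ∑ a ∈ Finset.range n, (f a 0 - f a n) :=
    Finset.sum_congr rfl fun a _ => Finset.sum_range_sub' (f a) n
  have hS2 : ∑ a ∈ Finset.range n, ∑ b ∈ Finset.range n, (g (a + 1) b - g a b)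
      = ∑ b ∈ Finset.range n, (g n b - g 0 b) := by
    rw [Finset.sum_comm]
    exact Finset.sum_congr rfl fun b _ => Finset.sum_range_sub (fun a => g a b) n
  rw [hS1, hS2, Finset.sum_sub_distrib, Finset.sum_sub_distrib]
  simp only [hf, hg, B5Block118.tstep_zero, add_zero]
  have h3 : ∀ t, x + tstep N μ t + tstep N ν n = x + tstep N ν n + tstep N μ t := fun t => add_right_comm _ _ _
  simp_rw [h3]
  ring

omit hN in
/-- a flat field has trivial holonomy around every square. [cite: Balaban1984PropagatorsI, (1.2) p.18] -/
theorem holonomy_square (A : Fld N) (hA : curvLin N A = 0) (x : Tor N) {μ ν : Fin d} (hμν : μ < ν) (n : ℕ) :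
    (∑ t : Fin n, A (x + tstep N μ t, μ)) + ∑ t : Fin n, A (x + tstep N μ n + tstep N ν t, ν)
      = (∑ t : Fin n, A (x + tstep N ν n + tstep N μ t, μ)) + ∑ t : Fin n, A (x + tstep N ν t, ν) := by
  have h := square_stokes N A x hμν n
  have h0 : ∀ i, curvFun N A i = 0 := fun i => by
    rw [← curvLin_apply, hA, PiLp.zero_apply]
  simp only [h0, Finset.sum_const_zero] at h
  rw [show (∑ t : Fin n, A (x + tstep N μ t, μ)) = ∑ t ∈ Finset.range n, A (x + tstep N μ t, μ) from
      Fin.sum_univ_eq_sum_range (fun t => A (x + tstep N μ t, μ)) n,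
    show (∑ t : Fin n, A (x + tstep N μ n + tstep N ν t, ν)) = ∑ t ∈ Finset.range n, A (x + tstep N μ n + tstep N ν t, ν)
      from Fin.sum_univ_eq_sum_range (fun t => A (x + tstep N μ n + tstep N ν t, ν)) n,
    show (∑ t : Fin n, A (x + tstep N ν n + tstep N μ t, μ)) = ∑ t ∈ Finset.range n, A (x + tstep N ν n + tstep N μ t, μ)
      from Fin.sum_univ_eq_sum_range (fun t => A (x + tstep N ν n + tstep N μ t, μ)) n,
    show (∑ t : Fin n, A (x + tstep N ν t, ν)) = ∑ t ∈ Finset.range n, A (x + tstep N ν t, ν) from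
      Fin.sum_univ_eq_sum_range (fun t => A (x + tstep N ν t, ν)) n]
  linarith

variable (n : ℕ) [NeZero n] (M : Fin d → ℕ) [hM : ∀ μ, NeZero (M μ)]

omit hN [NeZero n] hM in
/-- **flat fields average to flat fields**: if `∂A = 0` on `T_η` then `∂(QA) = 0` on `T₁^{(k)}` — the coarse
plaquette variable of `QA` is the block average of the holonomies of `A` around the `n × n` squares, by (1.18) and the
translation rule `B^k(y) + e_μ = B^k(y + e_μ)`. [cite: Balaban1984PropagatorsI, (1.18) p.20] -/
theorem curvLin_Qlin_eq_zero (A : Fld (fine n M)) (hA : curvLin (fine n M) A = 0) : curvLin M (Qlin n M A) = 0 := by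
  ext i
  obtain ⟨y, μ, ν⟩ := i
  rw [curvLin_apply, PiLp.zero_apply, curvFun]
  split_ifs with hμν
  · simp only [Qlin_apply, qFun]
    simp_rw [← B5Block118.bpt_add_tstep n M y]
    have hsum : (∑ j : Fin d → Fin n, ∑ t : Fin n, A (bpt n M y j + tstep (fine n M) μ t, μ))
        + (∑ j : Fin d → Fin n, ∑ t : Fin n, A (bpt n M y j + tstep (fine n M) μ n + tstep (fine n M) ν t, ν))
        - (∑ j : Fin d → Fin n, ∑ t : Fin n, A (bpt n M y j + tstep (fine n M) ν n + tstep (fine n M) μ t, μ))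
        - (∑ j : Fin d → Fin n, ∑ t : Fin n, A (bpt n M y j + tstep (fine n M) ν t, ν)) = 0 := by
      rw [← Finset.sum_add_distrib, ← Finset.sum_sub_distrib, ← Finset.sum_sub_distrib]
      refine Finset.sum_eq_zero fun j _ => ?_
      have h := holonomy_square (fine n M) A hA (bpt n M y j) hμν n
      linarith
    linear_combination (1 / (n : ℝ) ^ (d + 1)) * hsum
  · rfl

end Stokes


/-! ### §9.4  The hierarchical axial gauge is complete: positivity of `S` on `N(Q_k) ∩ {A, QA, …, Q_{k−1}A axial}` -/

section TowerPos

variable {d : ℕ} (L : ℕ) [NeZero L] (M : Fin d → ℕ) [hM : ∀ μ, NeZero (M μ)]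

omit [NeZero L] hM in
/-- `Q_{k+1} = Q_k ∘ Q` (definitional). [cite: Balaban1984PropagatorsI, (1.18) p.20] -/
theorem qk_succ (k : ℕ) : Qk L M (k + 1) = Qk L M k ∘ₗ Qlin L (towerM L M k) := rfl

omit hM in
/-- `AxAll (k+1) = Ax ⊓ Q⁻¹(AxAll k)` (definitional). [cite: Balaban1984PropagatorsI, (1.17) p.20] -/
theorem axAll_succ (k : ℕ) :
    AxAll L M (k + 1) = Ax L (towerM L M k) ⊓ (AxAll L M k).comap (Qlin L (towerM L M k)) := rfl

/-- `(ST)^{k+1}ρ = (ST)^k (S T ρ)` (definitional). [cite: Balaban1984PropagatorsI, (1.17) p.20] -/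
theorem iterST_succ (k : ℕ) (ρ : Fld (towerM L M (k + 1)) → ℝ) :
    iterST L M (k + 1) ρ = iterST L M k (scaleDens L (rtT L (towerM L M k) ρ)) := rfl

omit [NeZero L] hM in
/-- `Q_0 = 1` (definitional). [cite: Balaban1984PropagatorsI, (1.18) p.20] -/
theorem qk_zero : Qk L M 0 = LinearMap.id := rfl

omit hM in
/-- `AxAll 0 = ⊤` (definitional). [cite: Balaban1984PropagatorsI, (1.17) p.20] -/
theorem axAll_zero : AxAll L M 0 = ⊤ := rfl

/-- `(ST)⁰ρ = ρ` (definitional). [cite: Balaban1984PropagatorsI, (1.17) p.20] -/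
theorem iterST_zero (ρ : Fld (towerM L M 0) → ℝ) : iterST L M 0 ρ = ρ := rfl

omit hM in
/-- the composite direction space one level up (stated on the `fine L (towerM L M k)` carrier, to which
`Fld (towerM L M (k+1))`, `Qk L M (k+1)` and `AxAll L M (k+1)` reduce definitionally).
[cite: Balaban1984PropagatorsI, (1.17) p.20] -/
theorem mem_dirSpace_succ (k : ℕ) (A : Fld (fine L (towerM L M k))) :
    A ∈ dirSpace (Qk L M k ∘ₗ Qlin L (towerM L M k))
        (Ax L (towerM L M k) ⊓ (AxAll L M k).comap (Qlin L (towerM L M k))) ↔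
      A ∈ Ax L (towerM L M k) ∧ Qlin L (towerM L M k) A ∈ dirSpace (Qk L M k) (AxAll L M k) := by
  rw [mem_dirSpace_iff, mem_dirSpace_iff, LinearMap.comp_apply, Submodule.mem_inf, Submodule.mem_comap]
  tauto

omit hM in
/-- at level `0` the direction space is trivial (`Q_0 = 1`). [cite: Balaban1984PropagatorsI, (1.17) p.20] -/
theorem dirSpace_zero : dirSpace (Qk L M 0) (AxAll L M 0) = ⊥ := by
  rw [eq_bot_iff]
  intro A hA
  rw [mem_dirSpace_iff] at hA
  exact (Submodule.mem_bot ℝ).2 hA.1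

/-- **the hierarchical axial gauge is complete** (d ≥ 2): at every level `k` of the tower a field `A` with
`Q_kA = 0`, all of `A, QA, …, Q_{k−1}A` axial and `S(A) = 0` vanishes — induction on `k` from the p. 19 claim on
this carrier (`claimP19_tor`) and `∂A = 0 ⇒ ∂(QA) = 0` (`curvLin_Qlin_eq_zero`); this is what makes every integral in
(1.16)–(1.17) a convergent Gaussian integral. [cite: Balaban1984PropagatorsI, (1.17) p.20] -/
theorem tower_pos (hd : 2 ≤ d) : ∀ (k : ℕ) (A : Fld (towerM L M k)),
    A ∈ dirSpace (Qk L M k) (AxAll L M k) → action1 A = 0 → A = 0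
  | 0, A, hA, _ => by
      rw [dirSpace_zero, Submodule.mem_bot] at hA
      exact hA
  | k + 1, A, hA, hS => by
      replace hA := (mem_dirSpace_succ L M k A).1 hA
      have hflat : curvLin (fine L (towerM L M k)) A = 0 := (action1_eq_zero_iff A).1 hS
      have hQflat : curvLin (towerM L M k) (Qlin L (towerM L M k) A) = 0 :=
        curvLin_Qlin_eq_zero L (towerM L M k) A hflat
      have hQ0 : Qlin L (towerM L M k) A = 0 :=
        tower_pos hd k _ hA.2 ((action1_eq_zero_iff _).2 hQflat)
      have hA' : A ∈ dirSpace (Qlin L (towerM L M k)) (Ax L (towerM L M k)) :=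
        (mem_dirSpace_iff A).2 ⟨hQ0, hA.1⟩
      exact claimP19_tor L (towerM L M k) hd A hA' hS

end TowerPos

/-! ### §9.5  Convergence: `e^{−S}` is integrable along every (dilated, translated) composite fibre -/

section Convergence

open B5GaussSectC (gaussW gaussW_pos continuous_gaussW)

variable {E : Type*} [NormedAddCommGroup E] [InnerProductSpace ℝ E] [FiniteDimensional ℝ E]
  [MeasurableSpace E] [BorelSpace E]
variable {E' : Type*} [NormedAddCommGroup E'] [InnerProductSpace ℝ E'] [FiniteDimensional ℝ E']
variable (T : E →ₗ[ℝ] E') (N : Submodule ℝ E)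

omit [FiniteDimensional ℝ E'] in
/-- an AFFINE Gaussian `x ↦ γ_α(f + 𝒯x)` is integrable on `N` when `𝒯` is injective on `N`
(`γ_α(f + v) ≤ e^{‖f‖²/2α}·γ_{2α}(v)`). [cite: Balaban1984PropagatorsI, (1.17) p.20] -/
theorem integrable_gaussW_affine (h : ∀ x ∈ N, T x = 0 → x = 0) {α : ℝ} (hα : 0 < α) (f : E') :
    Integrable (fun x : N => gaussW E' α (f + T (x : E))) := by
  have hα2 : 0 < 2 * α := by positivity
  have h2 := (integrable_gaussW_T T N h hα2).const_mul (Real.exp (‖f‖ ^ 2 / (2 * α)))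
  refine h2.mono' ?_ ?_
  · have : Continuous fun x : N => f + T (x : E) :=
      continuous_const.add ((T.continuous_of_finiteDimensional).comp continuous_subtype_val)
    exact ((continuous_gaussW α).comp this).aestronglyMeasurable
  · refine Filter.Eventually.of_forall fun x => ?_
    rw [Real.norm_eq_abs, abs_of_pos (gaussW_pos α _), gaussW, gaussW, ← Real.exp_add]
    apply Real.exp_le_exp.mpr
    have hineq : ‖T (x : E)‖ ^ 2 ≤ 2 * ‖f + T (x : E)‖ ^ 2 + 2 * ‖f‖ ^ 2 := by
      have h1 : ‖T (x : E)‖ ≤ ‖f + T (x : E)‖ + ‖f‖ := by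
        have := norm_sub_le (f + T (x : E)) f
        rwa [add_sub_cancel_left] at this
      have h3 : ‖T (x : E)‖ ^ 2 ≤ (‖f + T (x : E)‖ + ‖f‖) ^ 2 := pow_le_pow_left₀ (norm_nonneg _) h1 2
      nlinarith [sq_nonneg (‖f + T (x : E)‖ - ‖f‖)]
    rw [show -‖f + T (x : E)‖ ^ 2 / (2 * α) = (-‖f + T (x : E)‖ ^ 2) * (1 / (2 * α)) by ring,
      show ‖f‖ ^ 2 / (2 * α) + -‖T (x : E)‖ ^ 2 / (2 * (2 * α))
        = (‖f‖ ^ 2 - ‖T (x : E)‖ ^ 2 / 2) * (1 / (2 * α)) by ring]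
    exact mul_le_mul_of_nonneg_right (by linarith) (by positivity)

variable {d : ℕ} (L : ℕ) [NeZero L] (M : Fin d → ℕ) [hM : ∀ μ, NeZero (M μ)]

/-- **convergence of (1.17)**: for `d ≥ 2` and every `c ≠ 0`, `A ↦ e^{−S(c·A)}` is integrable along every translate
of the level-`k` direction space `N(Q_k) ∩ {A, …, Q_{k−1}A axial}`. [cite: Balaban1984PropagatorsI, (1.17) p.20] -/
theorem integrable_exp_neg_action1_fibre (hd : 2 ≤ d) (k : ℕ) {c : ℝ} (hc : c ≠ 0) (A : Fld (towerM L M k)) :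
    Integrable (fun w : dirSpace (Qk L M k) (AxAll L M k) =>
      Real.exp (-action1 (c • (A + (w : Fld (towerM L M k)))))) := by
  have hT : ∀ x ∈ dirSpace (Qk L M k) (AxAll L M k), (c • curvLin (towerM L M k)) x = 0 → x = 0 := by
    intro x hx h0
    rw [LinearMap.smul_apply, smul_eq_zero] at h0
    exact tower_pos L M hd k x hx ((action1_eq_zero_iff x).2 (h0.resolve_left hc))
  have h := integrable_gaussW_affine (c • curvLin (towerM L M k)) (dirSpace (Qk L M k) (AxAll L M k)) hT one_pos
    (curvLin (towerM L M k) (c • A))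
  refine h.congr (Filter.Eventually.of_forall fun w => ?_)
  simp only [exp_neg_action1, smul_add, map_add, map_smul, LinearMap.smul_apply]

end Convergence


/-! ### §9.6  (1.17) for EVERY `k`: «It is easily seen that a composition of k transformations is given by …» -/

section Iterate

variable {d : ℕ} (L : ℕ) [NeZero L] (M : Fin d → ℕ) [hM : ∀ μ, NeZero (M μ)]

/-- **the k-fold iterate of `ST` on a general density**, by induction on `k`: `((ST)^k ρ)(B) = z^{(k)} ∫dA δ(B − Q_kA)
δ_Ax(Q_{k−1}A)⋯δ_Ax(A) ρ(σ^k A)` with `z^{(k)} > 0` independent of `ρ` and `B`, for every density integrable along the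
(dilated, translated) composite fibres — the step `k → k+1` is the δ-calculus identity (1.16) (`deltaInt_comp`, with
the axial section of §2b) after the scaling bookkeeping `deltaInt_smul_pt`. [cite: Balaban1984PropagatorsI, (1.17) p.20] -/
theorem iterST_eq_deltaInt : ∀ k : ℕ, ∃ z : ℝ, 0 < z ∧ ∀ (ρ : Fld (towerM L M k) → ℝ),
    (∀ A : Fld (towerM L M k), Integrable (fun w : dirSpace (Qk L M k) (AxAll L M k) =>
        ρ (sigmaL d L ^ k • (A + (w : Fld (towerM L M k)))))) →
    ∀ B : Fld M, iterST L M k ρ B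
      = z * deltaInt (Qk L M k) (AxAll L M k) (fun A => ρ (sigmaL d L ^ k • A)) B
  | 0 => by
      refine ⟨1, one_pos, fun ρ _ B => ?_⟩
      have hB : B ∈ fibre (Qk L M 0) (AxAll L M 0) B := ⟨rfl, Submodule.mem_top⟩
      rw [one_mul, iterST_zero, deltaInt_of_dirSpace_eq_bot (dirSpace_zero L M) _ hB, pow_zero, one_smul]
  | k + 1 => by
      obtain ⟨z, hz, hk⟩ := iterST_eq_deltaInt k
      obtain ⟨c, hc, hcomp⟩ := deltaInt_comp (Qk L M k) (AxAll L M k) (secLin L (towerM L M k))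
        (Qlin_secFld L (towerM L M k)) (secFld_mem_Ax L (towerM L M k))
      have hσ : 0 < sigmaL d L ^ (k + 1) := pow_pos (sigmaL_pos (d := d) L) _
      refine ⟨z * ((sigmaL d L ^ (k + 1)) ^ Module.finrank ℝ (dirSpace (Qlin L (towerM L M k)) (Ax L (towerM L M k)))
          * c), mul_pos hz (mul_pos (pow_pos hσ _) hc), fun ρ hρ B => ?_⟩
      rw [iterST_succ]
      -- the hypothesis, read on the `fine L (towerM L M k)` carrier (definitional unfolding of level `k+1`)
      have hρf : ∀ A : Fld (fine L (towerM L M k)),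
          Integrable (fun w : dirSpace (Qk L M k ∘ₗ Qlin L (towerM L M k))
              (compSub (Qlin L (towerM L M k)) (Ax L (towerM L M k)) (AxAll L M k)) =>
            ρ (sigmaL d L ^ (k + 1) • (A + (w : Fld (fine L (towerM L M k)))))) :=
        fun A => hρ A
      -- the new density `ρ' = S T ρ` read at the dilated point
      have hpt : ∀ X : Fld (towerM L M k),
          scaleDens L (rtT L (towerM L M k) ρ) (sigmaL d L ^ k • X)
            = (sigmaL d L ^ (k + 1)) ^ Module.finrank ℝ (dirSpace (Qlin L (towerM L M k)) (Ax L (towerM L M k)))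
              * deltaInt (Qlin L (towerM L M k)) (Ax L (towerM L M k))
                  (fun A => ρ (sigmaL d L ^ (k + 1) • A)) X := by
        intro X
        rw [scaleDens_apply, rtT, smul_smul, ← pow_succ', deltaInt_smul_pt _ _ _ hσ]
      -- the induction hypothesis applies to `ρ'`
      have hρ' : ∀ A : Fld (towerM L M k), Integrable (fun w : dirSpace (Qk L M k) (AxAll L M k) =>
          scaleDens L (rtT L (towerM L M k) ρ) (sigmaL d L ^ k • (A + (w : Fld (towerM L M k))))) := by
        intro A
        have h := (integrable_deltaInt_shift (Qk L M k) (AxAll L M k) (secLin L (towerM L M k))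
          (Qlin_secFld L (towerM L M k)) (secFld_mem_Ax L (towerM L M k))
          (fun A => ρ (sigmaL d L ^ (k + 1) • A)) hρf A).const_mul
          ((sigmaL d L ^ (k + 1)) ^ Module.finrank ℝ (dirSpace (Qlin L (towerM L M k)) (Ax L (towerM L M k))))
        refine h.congr (Filter.Eventually.of_forall fun w => ?_)
        simp only
        rw [hpt]
      rw [hk _ hρ' B, funext hpt, deltaInt_const_mul, hcomp _ B hρf]
      show _ = z * ((sigmaL d L ^ (k + 1)) ^ Module.finrank ℝ (dirSpace (Qlin L (towerM L M k)) (Ax L (towerM L M k)))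
          * c) * deltaInt (Qk L M k ∘ₗ Qlin L (towerM L M k))
            (compSub (Qlin L (towerM L M k)) (Ax L (towerM L M k)) (AxAll L M k))
            (fun A => ρ (sigmaL d L ^ (k + 1) • A)) B
      ring

omit hM in
/-- `η^{−(d−2)/2}·σ^k = 1` for `η = L^{−k}`. [cite: Balaban1984PropagatorsI, (1.5) p.18] -/
theorem eta_rpow_mul_sigmaL_pow (k : ℕ) :
    (((L : ℝ) ^ k)⁻¹) ^ (-(((d : ℝ) - 2) / 2)) * sigmaL d L ^ k = 1 := by
  have hL : (0 : ℝ) < L := by exact_mod_cast Nat.pos_of_ne_zero (NeZero.ne L)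
  have hLk : (0 : ℝ) < (L : ℝ) ^ k := pow_pos hL k
  have h1 : sigmaL d L ^ k = ((L : ℝ) ^ k) ^ (-(((d : ℝ) - 2) / 2)) := by
    rw [sigmaL, ← Real.rpow_natCast, ← Real.rpow_natCast (L : ℝ) k, ← Real.rpow_mul hL.le,
      ← Real.rpow_mul hL.le, mul_comm]
  rw [h1, Real.inv_rpow hLk.le, inv_mul_cancel₀ (Real.rpow_pos_of_pos hLk _).ne']

/-- **`S(σ^k A) = S^η(A)`**, `η = L^{−k}`: the unit-lattice action of the `k`-fold dilated field is the η-lattice action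
of (1.17) — (1.5) `B5SectAStatements.eq15` at `ε = L^{−k}`. [cite: Balaban1984PropagatorsI, (1.5) p.18] -/
theorem action1_sigma_pow_smul (k : ℕ) (A : Fld (towerM L M k)) :
    action1 (sigmaL d L ^ k • A) = actionEta L M k A := by
  have hL : (0 : ℝ) < L := by exact_mod_cast Nat.pos_of_ne_zero (NeZero.ne L)
  have hη : (0 : ℝ) < ((L : ℝ) ^ k)⁻¹ := inv_pos.mpr (pow_pos hL k)
  have h15 := B5SectAStatements.eq15 (towerM L M k) hη (cplx (sigmaL d L ^ k • A))
  have hres : B5SectAStatements.rescale15 (towerM L M k) ((L : ℝ) ^ k)⁻¹ (cplx (sigmaL d L ^ k • A)) = cplx A := by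
    rw [B5SectAStatements.rescale15, cplx_smul, smul_smul, ← Complex.ofReal_mul, eta_rpow_mul_sigmaL_pow,
      Complex.ofReal_one, one_smul]
  rw [hres, B5SectAStatements.action15, Complex.ofReal_inv, inv_inv, Complex.ofReal_pow,
    Complex.ofReal_natCast] at h15
  rw [action1, actionEta, eta, ← h15]

/-- **(1.17) PROVED for every `k`** (d ≥ 2, every `L ≥ 1`, every torus, U = 1): `((ST)^k e^{−S})(B) = z^{(k)} ∫dA
δ(B − Q_kA) δ_Ax(Q_{k−1}A)⋯δ_Ax(A) e^{−S^η(A)}` with a constant `z^{(k)} > 0`. [cite: Balaban1984PropagatorsI, (1.17) p.20] -/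
theorem eq117_holds (hd : 2 ≤ d) (k : ℕ) : Eq117 L M k := by
  obtain ⟨z, hz, h⟩ := iterST_eq_deltaInt L M k
  refine ⟨z, hz, fun B => ?_⟩
  have hint : ∀ A : Fld (towerM L M k), Integrable (fun w : dirSpace (Qk L M k) (AxAll L M k) =>
      Real.exp (-action1 (sigmaL d L ^ k • (A + (w : Fld (towerM L M k)))))) :=
    fun A => integrable_exp_neg_action1_fibre L M hd k (pow_ne_zero k (sigmaL_pos (d := d) L).ne') A
  rw [h (fun A => Real.exp (-action1 A)) hint B, rt17]
  simp_rw [action1_sigma_pow_smul]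

/-- **(1.16) PROVED** (d ≥ 2): the composition of two transformations. [cite: Balaban1984PropagatorsI, (1.16) p.20] -/
theorem eq116_holds (hd : 2 ≤ d) : Eq116 L M := eq117_holds L M hd 2

end Iterate

/-! ### §9.7  (1.19) for EVERY `k`: `((ST)^k e^{−S})(B) = Z_{k,Ax} exp(−½⟨B, Δ_kB⟩)` with explicit `Δ_k = W_k^†W_k` -/

section GaussK

open B5GaussSectC (gaussW gaussW_neg)

variable {d : ℕ} (L : ℕ) [NeZero L] (M : Fin d → ℕ) [hM : ∀ μ, NeZero (M μ)]

/-- **the composite axial section** `sec_k = sec ∘ ⋯ ∘ sec : Fld M → Fld (towerM k)`: a linear right inverse of `Q_k`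
with values in the hierarchical axial gauge. [cite: Balaban1984PropagatorsI, (1.17) p.20] -/
def secK : (k : ℕ) → (Fld M →ₗ[ℝ] Fld (towerM L M k))
  | 0 => LinearMap.id
  | k + 1 => secLin L (towerM L M k) ∘ₗ secK k

/-- `Q_k sec_k = 1`. [cite: Balaban1984PropagatorsI, (1.17) p.20] -/
theorem qk_secK : ∀ (k : ℕ) (B : Fld M), Qk L M k (secK L M k B) = B
  | 0, _ => rfl
  | k + 1, B => by
      show Qk L M k (Qlin L (towerM L M k) (secFld L (towerM L M k) (secK L M k B))) = B
      rw [Qlin_secFld]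
      exact qk_secK k B

/-- `sec_k B` is in the hierarchical axial gauge. [cite: Balaban1984PropagatorsI, (1.17) p.20] -/
theorem secK_mem : ∀ (k : ℕ) (B : Fld M), secK L M k B ∈ AxAll L M k
  | 0, _ => Submodule.mem_top
  | k + 1, B => by
      show secFld L (towerM L M k) (secK L M k B)
        ∈ Ax L (towerM L M k) ⊓ (AxAll L M k).comap (Qlin L (towerM L M k))
      refine Submodule.mem_inf.2 ⟨secFld_mem_Ax L (towerM L M k) _, ?_⟩
      rw [Submodule.mem_comap, Qlin_secFld]
      exact secK_mem k B

/-- `sec_k B` lies on the fibre of (1.17) over `B`. [cite: Balaban1984PropagatorsI, (1.17) p.20] -/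
theorem secK_mem_fibre (k : ℕ) (B : Fld M) : secK L M k B ∈ fibre (Qk L M k) (AxAll L M k) B :=
  ⟨qk_secK L M k B, secK_mem L M k B⟩

/-- the dilated curvature map `σ^k 𝒯` of level `k` (`e^{−S^η(A)} = γ₁(σ^k𝒯A)`). [cite: Balaban1984PropagatorsI, (1.19) p.20] -/
def Tk (k : ℕ) : Fld (towerM L M k) →ₗ[ℝ] Plaq (towerM L M k) := sigmaL d L ^ k • curvLin (towerM L M k)

/-- `e^{−S^η(A)} = γ₁(σ^k𝒯A)`. [cite: Balaban1984PropagatorsI, (1.19) p.20] -/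
theorem exp_neg_actionEta (k : ℕ) (A : Fld (towerM L M k)) :
    Real.exp (-actionEta L M k A) = gaussW (Plaq (towerM L M k)) 1 (Tk L M k A) := by
  rw [← action1_sigma_pow_smul, exp_neg_action1, Tk, LinearMap.smul_apply, map_smul]

/-- **`Z^{(k)}`-type normalisation** of the level-`k` Gaussian: `∫_{N_k} γ₁(σ^k𝒯w) dw`, `N_k = N(Q_k) ∩ {axial}`.
[cite: Balaban1984PropagatorsI, (1.19) p.20] -/
def Zk (k : ℕ) : ℝ := ZT (Tk L M k) (dirSpace (Qk L M k) (AxAll L M k)) 1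

/-- the linear map `W_k = (1 − R_k)σ^k𝒯∘sec_k`. [cite: Balaban1984PropagatorsI, (1.19) p.20] -/
def Wk (k : ℕ) : Fld M →ₗ[ℝ] Plaq (towerM L M k) :=
  (LinearMap.id - (Rim (Tk L M k) (dirSpace (Qk L M k) (AxAll L M k))).toLinearMap) ∘ₗ Tk L M k ∘ₗ secK L M k

/-- **`Δ_k = W_k^†W_k`**, explicitly. [cite: Balaban1984PropagatorsI, (1.19) p.20] -/
def DeltaK (k : ℕ) : Fld M →ₗ[ℝ] Fld M := LinearMap.adjoint (Wk L M k) ∘ₗ Wk L M k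

/-- `Δ_k` is symmetric. [cite: Balaban1984PropagatorsI, (1.19) p.20] -/
theorem DeltaK_symm (k : ℕ) (B B' : Fld M) : inner ℝ (DeltaK L M k B) B' = inner ℝ B (DeltaK L M k B') := by
  simp only [DeltaK, LinearMap.comp_apply, LinearMap.adjoint_inner_left, LinearMap.adjoint_inner_right]

/-- `⟨B, Δ_kB⟩ = ‖W_kB‖²`. [cite: Balaban1984PropagatorsI, (1.19) p.20] -/
theorem inner_DeltaK (k : ℕ) (B : Fld M) : inner ℝ B (DeltaK L M k B) = ‖Wk L M k B‖ ^ 2 := by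
  rw [DeltaK, LinearMap.comp_apply, LinearMap.adjoint_inner_right, real_inner_self_eq_norm_sq]

/-- **the right side of (1.17) is a Gaussian**: `∫dA δ(B − Q_kA)δ_Ax⋯δ_Ax e^{−S^η(A)} = Z^{(k)}·exp(−½⟨B, Δ_kB⟩)` for
every `B`, explicitly. [cite: Balaban1984PropagatorsI, (1.19) p.20] -/
theorem rt17_gauss (k : ℕ) (B : Fld M) : rt17 L M k B = Zk L M k * Real.exp (-S1 M (DeltaK L M k) B) := by
  rw [rt17, deltaInt_eq _ (secK_mem_fibre L M k B)]
  have hfun : (fun v : dirSpace (Qk L M k) (AxAll L M k) =>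
        Real.exp (-actionEta L M k (secK L M k B + (v : Fld (towerM L M k)))))
      = fun v : dirSpace (Qk L M k) (AxAll L M k) =>
          gaussW (Plaq (towerM L M k)) 1 ((-Tk L M k (secK L M k B)) - Tk L M k (v : Fld (towerM L M k))) := by
    funext v
    rw [exp_neg_actionEta, map_add, ← gaussW_neg]
    congr 1
    abel
  rw [hfun, integral_gaussW_sub_T (Tk L M k) (dirSpace (Qk L M k) (AxAll L M k)) 1, Zk, S1, inner_DeltaK, gaussW,
    map_neg]
  congr 2
  rw [show -Tk L M k (secK L M k B) - -(Rim (Tk L M k) (dirSpace (Qk L M k) (AxAll L M k))) (Tk L M k (secK L M k B))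
      = -(Tk L M k (secK L M k B) - (Rim (Tk L M k) (dirSpace (Qk L M k) (AxAll L M k))) (Tk L M k (secK L M k B)))
      by abel, norm_neg]
  rw [show Wk L M k B = Tk L M k (secK L M k B)
      - (Rim (Tk L M k) (dirSpace (Qk L M k) (AxAll L M k))) (Tk L M k (secK L M k B)) from rfl]
  ring

/-- **`Z^{(k)} > 0`** (d ≥ 2): the hierarchical axial gauge is complete (`tower_pos`). [cite: Balaban1984PropagatorsI, (1.19) p.20] -/
theorem Zk_pos (hd : 2 ≤ d) (k : ℕ) : 0 < Zk L M k := by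
  rw [Zk]
  refine ZT_pos_of_injOn (Tk L M k) (dirSpace (Qk L M k) (AxAll L M k)) (fun A hA h0 => ?_) one_pos
  rw [Tk, LinearMap.smul_apply, smul_eq_zero] at h0
  exact tower_pos L M hd k A hA
    ((action1_eq_zero_iff A).2 (h0.resolve_left (pow_ne_zero k (sigmaL_pos (d := d) L).ne')))

/-- **(1.19) PROVED for every `k`** (d ≥ 2): `((ST)^k e^{−S})(B) = Z_{k,Ax} exp(−½⟨B, Δ_kB⟩)` with `Z_{k,Ax} = z^{(k)}Z^{(k)}
> 0` and the explicit symmetric `Δ_k = W_k^†W_k`. [cite: Balaban1984PropagatorsI, (1.19) p.20] -/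
theorem eq119_holds (hd : 2 ≤ d) (k : ℕ) : Eq119 L M k := by
  obtain ⟨z, hz, h⟩ := eq117_holds L M hd k
  refine ⟨z * Zk L M k, mul_pos hz (Zk_pos L M hd k), DeltaK L M k, DeltaK_symm L M k, fun B => ?_⟩
  rw [h B, rt17_gauss, mul_assoc]

end GaussK

end

end Literature.MathematicalPhysics.QuantumFieldTheory.Balaban1983to89.B5Eq114Gauss
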